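import Literature.NumberTheory.Automorphic.AsaiSignArchParityCentre
import Literature.NumberTheory.Automorphic.AutomorphicTwistHecke
import Literature.NumberTheory.Automorphic.TwistedAsaiPole
import Literature.NumberTheory.Automorphic.BaseChangeCyclicCuspidalProofs
import Literature.NumberTheory.GaloisRepresentations.HeckeCharacterExtensionQuadraticCMProofs
import Literature.NumberTheory.GaloisRepresentations.HeckeCharacterExtensionQuadraticGeneralProofs
import Literature.NumberTheory.GaloisRepresentations.HeckeLFunctionAnalyticProofs
import HarnessLib

/-!
# Mok's archimedean parity of the Asai sign for odd `N` and `κ = -1`: the twist by `𝒵_E^-`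

Topic `NumberTheory/Automorphic`; namespace `Literature.NumberTheory.Automorphic`. Proof file
(theorems only: no definition, no named fact, no instance), sibling of `AsaiSign` (the named fact
`Mok2014_archimedean_parity_of_asaiSign`: C. P. Mok, Mem. AMS 235 (2015) no. 1108, Thm. 2.4.10 with
Lemma 2.2.1, Remark 2.2.2 and Cor. 2.5.5, coset form), of `AsaiSignArchParityCentre` (its stratum `N` odd,
`κ = +1`: the centre of a standard weak base change) and of `TwistedAsaiPole` (twisted partial Asai
products).

## The idea: Mok's device `L(s, Π, As⁻) = L(s, Π ⊗ χ_-, As⁺)`, `χ_- ∈ 𝒵_E^-`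

For odd `N` the parity of Mok's Cor. 2.5.5 is visible on the determinant, i.e. on the central character
`ω_Π` (`AsaiSignArchParityCentre`): a conjugate self-dual cuspidal `Π` of odd rank with `κ = +1` is a
standard weak base change from `U_{E/F}(N)` (the named fact `Mok2014_standardBaseChange_descent`, Mok's
Thm. 2.4.2 / 2.5.4 (a)), hence `ω_Π|_{𝕀_F} = 1` and `∑ a_i ∈ ℤ`.  The sign `κ = -1` is the TWISTED descent
`ξ_{χ_-}`, which the tree does not vendor; but Mok reduces it to the standard one by twisting with a
character `χ_- ∈ 𝒵_E^-` = {unitary characters of `𝕀_E/Eˣ` with `χ|_{𝕀_F} = ω_{E/F}`} (§2.1, arXiv p. 7,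
and the commutative diagram closing §2.1: twisting by `χ' ∈ 𝒵_E^{κ'}` multiplies signatures by `κ'`;
§2.5, p. 20: "for `χ_- ∈ 𝒵_E^-`, we have `L(s, φ^N, As⁻) = L(s, φ^N ⊗ χ_-, As⁺)`"; p. 21: "with a
similar result for the twisted base change").  Everything this device needs about the twist
`Π' = Π ⊗ (μ ∘ det)` of a Borel–Jacquet datum (`exists_cuspidalAutomorphicRepData_twist_hecke`) is proved
here on the tree's raw interfaces, with NO archimedean computation and NO analysis:

* `AutomorphicRepData.HasSatakeParamAt.heckeTwist`, `.of_heckeTwist` — `t_{Π ⊗ μ, w} = μ(ϖ_w) t_{Π, w}`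
  at EVERY place where `μ` is unramified (a level of `μ ∘ det` prime to `w`,
  `HeckeCharacter.exists_level_not_dvd_of_isUnramifiedAt`; Arthur–Clozel, Ch. 3 p. 172), and back.
* `AutomorphicRepData.centralCharacter_heckeTwist_eq` — `ω_{Π ⊗ μ} = μ^N ω_Π` (Satake shadows and
  rigidity of Hecke characters).
* `HeckeCharacter.apply_smul_mul_eq_one_of_restrict` — a character over a character trivial on the norm
  group is conjugate self-dual, `μ(c • y) μ(y) = 1` (Mok p. 7: "`χ|_{𝔸_F^×} = 1` or `ω_{E/F}` implies
  `χ ∘ c = χ⁻¹`"); `AutomorphicRepData.IsConjSelfDualAE.heckeTwist` — so `Π ⊗ μ` is again conjugate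
  self-dual a.e.
* `AutomorphicRepData.HasAsaiPole.heckeTwist_neg` (**the device**) — for `μ|_{𝕀_F} = ω_{E/F}` (the
  class-field character `η₀`) unramified at the places unramified over `F`: `HasAsaiPole c η Π` implies
  `HasAsaiPole c (-η) (Π ⊗ μ)`.  An Asai datum `(S, A')` of `Π ⊗ μ` pulls back to the Asai datum
  `(S, μ(ϖ)⁻¹ A')` of `Π`, and the two partial Euler products agree FACTOR BY FACTOR
  (`partialAsaiL_twist_eq_partialAsaiLTwist`, `partialAsaiLTwist_quadraticSign`), because
  `μ(ϖ_w) = ω_{E/F}(ϖ_v) = -1` at an inert unramified `w ∣ v` and `μ(ϖ_w) μ(ϖ_{c w}) = ω_{E/F}(ϖ_v) = 1` at a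
  split one (`HeckeCharacter.valueAtUniformizer_restrict_of_smul_eq/_ne`,
  `IsClassFieldCharacter.valueAtUniformizer_under_eq_neg_one`); `.heckeTwist_pos` — `𝒵_E^+`-twists
  preserve the pole; `HasAsaiSign.heckeTwist_neg/_pos` — the signature rule `κ ↦ κ κ'`.
* `exists_heckeCharacter_restrict_eq_classFieldCharacter` — **`𝒵_E^- ≠ ∅`** from the named fact
  `HewittRoss_heckeCharacter_extension_quadratic` (Hewitt–Ross (24.12)), with unramifiedness at the places
  unramified over `F`; `…_of_isTotallyComplex` — unconditionally for `F` totally real, `E` totally complex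
  (the tree's theorem `HeckeCharacter.exists_extension_quadratic_of_isTotallyComplex_of_isFiniteOrder`,
  Weil's method).
* `CuspidalAutomorphicRepData.restrict_centralCharacter_eq_of_hasAsaiSign_neg_one` — **for odd `N`, an
  `As⁻` pole forces `ω_Π|_{𝕀_F} = ω_{E/F}`**, granted `Mok2014_standardBaseChange_descent`: twist by
  `μ ∈ 𝒵_E^-`, descend `Π ⊗ μ` (it has `HasAsaiSign c 1`), read the centre
  (`restrict_centralCharacter_eq_one_of_isWeakBaseChange`): `(μ^N ω)|_{𝕀_F} = 1`, `ω|_{𝕀_F} = η₀^{-N} = η₀`.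
* `Mok2014_archimedean_parity_of_asaiSign_odd_neg_of_heckeCharacter(_of_two_mul)` (**main**) — `N` odd,
  `κ = -1`: the exponents `χ σ ⊆ r + ℤ` at a `c`-conjugation embedding lie in `1/2 + ℤ`
  (`= (N-1)/2 + (1-κ)/4 + ℤ`), from `ω|_{𝕀_F} = ω_{E/F}` through the unconditional dichotomy
  `sum_archParameter_int_or_half_of_isConjSelfDualAE` (`e^{2πi ∑ χ(σ)} = ω((-1)_w) = ω_{E/F, v}(-1) = -1`)
  and `r = N r - ((N-1)/2)(2r)`; no regularity hypothesis; `2r ∈ ℤ` or an infinity type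
  (`exists_int_two_mul_of_coset`).
* `Mok2014_archimedean_parity_of_asaiSign_odd_neg_of_facts(_of_two_mul)` — the stratum "`N` odd,
  `κ = -1`" of the named fact from `Mok2014_standardBaseChange_descent` ∧
  `HewittRoss_heckeCharacter_extension_quadratic` (∧ infinity types); `…_of_isTotallyComplex(_of_two_mul)` —
  the CM case from the descent alone; `Mok2014_archimedean_parity_of_asaiSign_odd_of_facts` — **the whole
  odd-rank half of the fact** (with `AsaiSignArchParityCentre` for `κ = +1`);
  `Mok2014_archimedean_parity_of_asaiSign_of_facts_of_even` — the fact reduced to its stratum `N` even;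
  `CuspidalAutomorphicRepData.not_hasAsaiSign_neg_one_of_odd_of_mem_int` — currency-free contrapositive:
  for odd `N`, integral exponents exclude the raw sign `-1` (Cor. 2.5.5 for odd `N`, without
  `a_1 > ⋯ > a_N`).

* Currency-free core (§ `TwistCentre`):
  `AutomorphicRepData.restrict_centralCharacter_mul_pow_eq_one_of_isWeakBaseChange_heckeTwist` — if the
  `𝒵_E`-twist `P ⊗ μ` is a standard weak base change then `ω_P|_{𝕀_F} · (μ|_{𝕀_F})^N = 1` (no descent
  fact); `…_of_odd` (`ω_P|_{𝕀_F} = μ|_{𝕀_F}`), `…_of_even` (`ω_P|_{𝕀_F} = 1`: the centre is blind in even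
  rank); `Mok2014_archimedean_parity_of_asaiSign_odd_neg_of_isWeakBaseChange_heckeTwist_of_two_mul` — the
  stratum's conclusion from "the twist is a standard weak base change", in no particular currency;
  `CuspidalAutomorphicRepData.not_isWeakBaseChange_heckeTwist_of_odd_of_mem_int` — FACT-FREE: for odd `N`
  and integral exponents, `P ⊗ χ_-` is not a standard weak base change ("`Π` does not descend via twisted
  base change", Cor. 2.5.5, p. 21, without regularity).
* Continuation currency (§ `ContCurrency`): `eval_asaiLocalPolynomial_heckeTwist_neg` (the factor-by-factor
  identity), `AutomorphicRepData.HasAsaiPoleCont.heckeTwist_neg`, `HasAsaiSignCont.heckeTwist_neg`, and the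
  odd-rank strata of the twin fact `Mok2014_archimedean_parity_of_asaiSignCont` from a continuation-currency
  standard descent displayed as a hypothesis (`…asaiSignCont_odd_neg/pos_of_contDescent_of_two_mul`).

What this does NOT give: anything for even `N` (the centre is blind there; Mok's Thm. 2.4.10 at the
archimedean place is needed beyond its determinant — the twin fact
`Mok2014_archimedean_parity_of_asaiSignCont` and `Mok2014_archimedean_parity_of_asaiSign_of_facts` of
`AsaiSignContOfRawPole`), and the inputs `Mok2014_standardBaseChange_descent` (the trace formula) and
`HewittRoss_heckeCharacter_extension_quadratic` (Pontryagin duality), named facts of the tree.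

## References

* C. P. Mok, *Endoscopic classification of representations of quasi-split unitary groups*,
  Mem. Amer. Math. Soc. 235 (2015), no. 1108 = arXiv:1206.0882: §2.1 (p. 7: `𝒵_E = 𝒵_E^+ ⊔ 𝒵_E^-`,
  (2.1.4)–(2.1.9), the last commutative diagram and "the signature of `χ̃` is `κ' κ_i`", p. 8), Thm. 2.4.2
  (p. 13), §2.5 (p. 20: `L(s, φ^N, As⁻) = L(s, φ^N ⊗ χ_-, As⁺)`), Thm. 2.5.4 (a) and the Remark after it,
  Cor. 2.5.5 (p. 21); read: `lit read arxiv:1206.0882`, pp. 7, 20, 21. [Mok2014]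
* W. T. Gan, B. Gross, D. Prasad, *Symplectic local root numbers, central critical `L`-values, and
  restriction problems*, Astérisque 346 (2012) = arXiv:0909.2999, §3 (before Lemma 3.4; Lemma 3.4) and §7
  (`As⁻ = As⁺ ⊗ ω_{k/k₀}`). [GanGrossPrasad2012]
* Y. Flicker, *Twisted tensors and Euler products*, Bull. SMF 116 (1988), p. 296. [Flicker1988]
* J. Arthur, L. Clozel, *Simple algebras, base change, and the advanced theory of the trace formula*,
  Ann. of Math. Stud. 120 (1989), Ch. 3, proof of Thm. 3.1 (p. 172: `t_{π ⊗ η, v}`; p. 201: `η(ϖ_v)`).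
  [ArthurClozelAMS120]
* E. Hewitt, K. A. Ross, *Abstract Harmonic Analysis* I (1979), Thm. (24.12). [HewittRoss1979]
* A. Weil, *On a certain type of characters of the idèle-class group of an algebraic number-field*
  (1956), §1. [Weil1956]
* L. Clozel, *Motifs et formes automorphes* (1990), §3.3 and Lemme 4.9. [Clozel1990]
* J. W. S. Cassels, A. Fröhlich (eds.), *Algebraic Number Theory* (1967), Ch. VII (Tate), §1.1, §4
  Prop. 4.1, §5.1 Main Theorem (B). [CasselsFrohlichANT1967]
-/

noncomputable section

open scoped MatrixGroups Matrix Classical NumberField ComplexConjugate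
open NumberField NumberField.InfinitePlace NumberField.mixedEmbedding IsDedekindDomain Filter

namespace Literature.NumberTheory.Automorphic

open Literature.NumberTheory.GaloisRepresentations

/-! ### Satake parameters of a twist `π ⊗ (μ ∘ det)` at every unramified place of `μ` -/

section SatakeTwist

variable {K : Type} [Field K] [NumberField K] {n : ℕ} {hcpt : isCompact_glFiniteIntegralLevel n K}

/-- **`t_{π ⊗ μ, v} = μ(ϖ_v) t_{π, v}` at EVERY place where `μ` is unramified** (no exceptional level):
if `π'` is the twist of `π` by `μ ∘ det` (`π'.W = (μ∘det) · π.W`, `π'.W' = (μ∘det) · π.W'`,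
`exists_automorphicRepData_twist_hecke`) and `π` has Satake parameter `α` at a place `v` where `μ` is
unramified, then `π'` has Satake parameter `μ(ϖ_v) · α` at `v` — `μ ∘ det` admits a level prime to `v`
(`HeckeCharacter.exists_level_not_dvd_of_isUnramifiedAt`), so
`HasSatakeParamAt.map_mulChar_detTwist_hecke_of_isUnramifiedAt` applies.  Arthur–Clozel 1989, Ch. 3,
proof of Thm. 3.1 (p. 172): `t_{π ⊗ η, v} = η(ϖ_v) t_{π, v}`.
[cite: ArthurClozelAMS120, Ch. 3, proof of Thm. 3.1 (p. 172)] -/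
theorem AutomorphicRepData.HasSatakeParamAt.heckeTwist
    {π π' : AutomorphicRepData (AutomorphyDatum.gl n K hcpt)} {v : HeightOneSpectrum (𝓞 K)}
    {α : Multiset ℂ} (h : π.HasSatakeParamAt v α) (μ : HeckeCharacter K) (hv : μ.IsUnramifiedAt v)
    (hW : π'.W = π.W.map (mulChar (detTwist n μ)))
    (hW' : π'.W' = π.W'.map (mulChar (detTwist n μ))) :
    π'.HasSatakeParamAt v (α.map (μ.valueAtUniformizer v * ·)) := by
  obtain ⟨𝔪, h𝔪, hv𝔪, hμ𝔪⟩ := HeckeCharacter.exists_level_not_dvd_of_isUnramifiedAt n hv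
  exact h.map_mulChar_detTwist_hecke_of_isUnramifiedAt μ h𝔪 hμ𝔪 hv𝔪 hv hW hW'

/-- **Untwisting**: in the situation of `HasSatakeParamAt.heckeTwist`, `π` is the twist of `π'` by
`μ⁻¹ ∘ det`, so a Satake parameter `β` of `π'` at a place `v` where `μ` is unramified gives the Satake
parameter `μ(ϖ_v)⁻¹ · β` of `π` at `v`. [cite: ArthurClozelAMS120, Ch. 3, proof of Thm. 3.1 (p. 172)] -/
theorem AutomorphicRepData.HasSatakeParamAt.of_heckeTwist
    {π π' : AutomorphicRepData (AutomorphyDatum.gl n K hcpt)} {v : HeightOneSpectrum (𝓞 K)}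
    {β : Multiset ℂ} (h : π'.HasSatakeParamAt v β) (μ : HeckeCharacter K) (hv : μ.IsUnramifiedAt v)
    (hW : π'.W = π.W.map (mulChar (detTwist n μ)))
    (hW' : π'.W' = π.W'.map (mulChar (detTwist n μ))) :
    π.HasSatakeParamAt v (β.map ((μ.valueAtUniformizer v)⁻¹ * ·)) := by
  have hWi : π.W = π'.W.map (mulChar (detTwist n μ⁻¹)) := by
    rw [hW, detTwist_inv, map_mulChar_inv_map_mulChar]
  have hWi' : π.W' = π'.W'.map (mulChar (detTwist n μ⁻¹)) := by
    rw [hW', detTwist_inv, map_mulChar_inv_map_mulChar]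
  have h' := h.heckeTwist μ⁻¹ (HeckeCharacter.isUnramifiedAt_inv_iff.2 hv) hWi hWi'
  rwa [HeckeCharacter.valueAtUniformizer_inv] at h'

/-- **The central characters of `π` and `π ⊗ (μ ∘ det)`: `ω_{π ⊗ μ} = μ^n ω_π`.**  If `ω` carries the
Satake shadow of the central character of `π` (`ω(ϖ_v) = ∏ t_{π,v}` wherever `π` is unramified,
`AutomorphicRepData.exists_centralCharacter`) and `ω'` that of the twist `π'`, then `ω' = μ^n · ω`:
at almost every `v` (Flath: `π` unramified, `hasSatakeParamAt_cofinite_holds`; `μ` unramified)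
`ω'(ϖ_v) = ∏ (μ(ϖ_v) t_{π,v,i}) = μ(ϖ_v)^n ω(ϖ_v)`, and a Hecke character is determined by almost all of
its values at uniformizers (`HeckeCharacter.ext_of_eventually_valueAtUniformizer_eq`).
Borel–Jacquet 1979, 5.7; Arthur–Clozel 1989, Ch. 3 §1 (`π ⊗ χ` has central character `ω_π χ^n`).
[cite: BorelJacquetCorvallis1979, §4.6 and 5.7] [cite: CasselsFrohlichANT1967, Ch. VII §4 Prop. 4.1 (proof)] -/
theorem AutomorphicRepData.centralCharacter_heckeTwist_eq
    {π π' : AutomorphicRepData (AutomorphyDatum.gl n K hcpt)} {ω ω' : HeckeCharacter K}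
    (hω : ∀ {v : HeightOneSpectrum (𝓞 K)} {α : Multiset ℂ}, π.HasSatakeParamAt v α →
      ω.IsUnramifiedAt v ∧ ω.valueAtUniformizer v = α.prod)
    (hω' : ∀ {v : HeightOneSpectrum (𝓞 K)} {α : Multiset ℂ}, π'.HasSatakeParamAt v α →
      ω'.IsUnramifiedAt v ∧ ω'.valueAtUniformizer v = α.prod)
    (μ : HeckeCharacter K) (hW : π'.W = π.W.map (mulChar (detTwist n μ)))
    (hW' : π'.W' = π.W'.map (mulChar (detTwist n μ))) : ω' = μ ^ n * ω := by
  refine HeckeCharacter.ext_of_eventually_valueAtUniformizer_eq ?_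
  have hur : ∀ᶠ v : HeightOneSpectrum (𝓞 K) in cofinite, μ.IsUnramifiedAt v :=
    μ.finite_ramifiedPlaces_iff.1 (HeckeCharacter.finite_ramifiedPlaces_holds _)
  filter_upwards [π.hasSatakeParamAt_cofinite_holds, hur] with v hπ hμ
  obtain ⟨α, hα⟩ := hπ
  have hα' := hα.heckeTwist μ hμ hW hW'
  rw [(hω' hα').2, HeckeCharacter.valueAtUniformizer_mul, HeckeCharacter.valueAtUniformizer_pow,
    (hω hα).2, Multiset.prod_map_mul, Multiset.map_const', Multiset.prod_replicate, Multiset.map_id',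
    hα.card_eq]

end SatakeTwist

/-! ### Conjugate self-dual characters of `𝕀_E` (Mok's `𝒵_E`) and the twist of a conjugate
self-dual representation -/

section ConjSelfDual

variable {F E : Type} [Field F] [NumberField F] [Field E] [NumberField E] [Algebra F E]
  {N : ℕ} {hcpt : isCompact_glFiniteIntegralLevel N E}

/-- **A character of `𝕀_E/Eˣ` whose restriction to `𝕀_F` is trivial on the norm group is conjugate
self-dual: `μ(c • y) μ(y) = 1`** (`E/F` quadratic, `c ≠ 1`): `y · (c • y) = N_{E/F}(y)_E` is the base
change of the relative norm, on which `μ` is `μ|_{𝕀_F}(N y) = 1`.  This is Mok's remark "the condition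
`χ|_{𝔸_F^×} = 1` or `ω_{E/F}` implies the conjugate self-duality condition `χ ∘ c = χ⁻¹`" defining
`𝒵_E = 𝒵_E^+ ⊔ 𝒵_E^-` (§2.1, arXiv p. 7). [cite: Mok2014, §2.1 (2.1.4)–(2.1.6), arXiv p. 7] -/
theorem _root_.Literature.NumberTheory.GaloisRepresentations.HeckeCharacter.apply_smul_mul_eq_one_of_restrict
    (h2 : Module.finrank F E = 2) {c : E ≃ₐ[F] E} (hc : c ≠ 1) {μ : HeckeCharacter E}
    {ψ : HeckeCharacter F} (hres : ∀ x, μ (AdeleRing.ideleBaseChange F E x) = ψ x)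
    (hψ : ψ.IsTrivialOnNormGroup E) (y : ideleGroup E) : μ (c • y) * μ y = 1 := by
  haveI : FiniteDimensional F E := Module.finite_of_finrank_eq_succ h2
  haveI : Algebra.IsQuadraticExtension F E := ⟨h2⟩
  haveI : IsGalois F E := inferInstance
  have h := hψ.apply_ideleRelNorm E y
  rw [← hres, AdeleRing.ideleBaseChange_ideleRelNorm, ideleGalNorm_eq_mul_smul h2 hc, map_mul,
    mul_comm] at h
  exact h

omit [NumberField F] in
/-- **`μ(ϖ_{c • w}) μ(ϖ_w) = 1` at the unramified places of a conjugate self-dual character.**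
[cite: Mok2014, §2.1 (2.1.4), arXiv p. 7] [cite: CasselsFrohlichANT1967, Ch. VII §1.1] -/
theorem _root_.Literature.NumberTheory.GaloisRepresentations.HeckeCharacter.valueAtUniformizer_smul_mul_eq_one
    {c : E ≃ₐ[F] E} {μ : HeckeCharacter E} (hdual : ∀ y : ideleGroup E, μ (c • y) * μ y = 1)
    {w : HeightOneSpectrum (𝓞 E)} (hw : μ.IsUnramifiedAt (c • w)) :
    μ.valueAtUniformizer (c • w) * μ.valueAtUniformizer w = 1 := by
  obtain ⟨μc, hμc⟩ := μ.exists_galConj c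
  have hone : μc * μ = 1 :=
    HeckeCharacter.ext fun y => by rw [HeckeCharacter.mul_apply, hμc, HeckeCharacter.one_apply, hdual]
  have h1 : (1 : HeckeCharacter E).valueAtUniformizer w = 1 := by
    rw [HeckeCharacter.valueAtUniformizer, HeckeCharacter.localComponent_apply,
      HeckeCharacter.one_apply, Units.val_one]
  rw [← HeckeCharacter.valueAtUniformizer_galConj hμc hw, ← HeckeCharacter.valueAtUniformizer_mul,
    hone, h1]

omit [NumberField F] in
/-- **The twist of a conjugate self-dual representation by a conjugate self-dual character is
conjugate self-dual** (almost everywhere on Satake parameters): if `t_{P, c w} = t_{P, w}⁻¹` a.e. and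
`μ(c • y) μ(y) = 1`, then `t_{P ⊗ μ, c w} = μ(ϖ_{c w}) t_{P, c w} = (μ(ϖ_w) t_{P, w})⁻¹ = t_{P ⊗ μ, w}⁻¹`
a.e. — the signature calculus of Mok, §2.1 (the commutative diagram closing §2.1, arXiv pp. 7–8:
twisting by `χ' ∈ 𝒵_E^{κ'}` multiplies signatures), read on Satake parameters.
[cite: Mok2014, §2.1 (last diagram) and §2.3, arXiv pp. 7–8, 11] -/
theorem AutomorphicRepData.IsConjSelfDualAE.heckeTwist
    {P P' : AutomorphicRepData (AutomorphyDatum.gl N E hcpt)} {c : E ≃ₐ[F] E}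
    (hcsd : P.IsConjSelfDualAE c) {μ : HeckeCharacter E}
    (hdual : ∀ y : ideleGroup E, μ (c • y) * μ y = 1)
    (hW : P'.W = P.W.map (mulChar (detTwist N μ))) (hW' : P'.W' = P.W'.map (mulChar (detTwist N μ))) :
    P'.IsConjSelfDualAE c := by
  have hur : ∀ᶠ w : HeightOneSpectrum (𝓞 E) in cofinite, μ.IsUnramifiedAt w :=
    μ.finite_ramifiedPlaces_iff.1 (HeckeCharacter.finite_ramifiedPlaces_holds _)
  have hinj : Function.Injective fun w : HeightOneSpectrum (𝓞 E) => c • w := MulAction.injective c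
  have hur' := hinj.tendsto_cofinite.eventually hur
  filter_upwards [hcsd, hur, hur'] with w hw hu hu' α β hα hβ
  have hαP := hα.of_heckeTwist μ hu hW hW'
  have hβP := hβ.of_heckeTwist μ hu' hW hW'
  have key := hw _ _ hαP hβP
  have huu := HeckeCharacter.valueAtUniformizer_smul_mul_eq_one hdual hu'
  set u := μ.valueAtUniformizer w with hu_def
  set u' := μ.valueAtUniformizer (c • w) with hu'_def
  have hu'0 : u' ≠ 0 := by
    rw [hu'_def, HeckeCharacter.valueAtUniformizer]
    exact Units.ne_zero _
  -- undo the scaling by `u'⁻¹` on the left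
  have e1 : β = (β.map (u'⁻¹ * ·)).map (u' * ·) := by
    rw [Multiset.map_map]
    conv_lhs => rw [← Multiset.map_id' β]
    refine Multiset.map_congr rfl fun b _ => ?_
    simp only [Function.comp_apply, ← mul_assoc, mul_inv_cancel₀ hu'0, one_mul]
  rw [e1, key, Multiset.map_map, Multiset.map_map]
  refine Multiset.map_congr rfl fun a _ => ?_
  simp only [Function.comp_apply, mul_inv, inv_inv, ← mul_assoc]
  rw [show u' * u * a⁻¹ = a⁻¹ by rw [huu, one_mul]]

end ConjSelfDual

/-! ### A character of `𝕀_E` over the class-field character `ω_{E/F}` at the unramified places: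
`μ(ϖ_w) = ω_{E/F}(ϖ_v) = -1` at an inert `w ∣ v`, `μ(ϖ_w) μ(ϖ_{c w}) = ω_{E/F}(ϖ_v) = 1` at a split one -/

section Values

variable {F E : Type} [Field F] [NumberField F] [Field E] [NumberField E] [Algebra F E]

/-- **Restriction at an inert place**: if `c • w = w`, `e(w|v) = 1` and `μ` is unramified at `w`, then
`μ|_{𝕀_F}(ϖ_v) = μ(ϖ_w)` (`w` is the only place above `v`, and `ϖ_v` stays a uniformizer in `E_w`).
[folklore] -/
theorem _root_.Literature.NumberTheory.GaloisRepresentations.HeckeCharacter.valueAtUniformizer_restrict_of_smul_eq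
    (h2 : Module.finrank F E = 2) {c : E ≃ₐ[F] E} (hc : c ≠ 1) {μ : HeckeCharacter E}
    {ψ : HeckeCharacter F} (hres : ∀ x, μ (AdeleRing.ideleBaseChange F E x) = ψ x)
    {w : HeightOneSpectrum (𝓞 E)} (hcw : c • w = w) (he : w.asIdeal.ramificationIdx (𝓞 F) = 1)
    (hunr : μ.IsUnramifiedAt w) : ψ.valueAtUniformizer (w.under (𝓞 F)) = μ.valueAtUniformizer w := by
  have huniq : ∀ w' : HeightOneSpectrum (𝓞 E), w'.under (𝓞 F) = w.under (𝓞 F) → w' = w := by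
    intro w' hw'
    rcases HeightOneSpectrum.eq_or_eq_smul_of_under_eq h2 hc hw' with h | h
    · exact h
    · exact h.trans hcw
  have hT : ∀ w' : HeightOneSpectrum (𝓞 E), w' ∈ ({w} : Finset (HeightOneSpectrum (𝓞 E))) ↔
      w'.under (𝓞 F) = w.under (𝓞 F) := fun w' => by
    rw [Finset.mem_singleton]
    exact ⟨fun h => by rw [h], huniq w'⟩
  rw [HeckeCharacter.valueAtUniformizer_restrict (fun x => (hres x).symm) {w} hT
    (fun w' hw' => by rw [huniq w' hw']; exact he) (fun w' hw' => by rw [huniq w' hw']; exact hunr),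
    Finset.prod_singleton]

/-- **Restriction at a split place**: if `c • w ≠ w`, `e(w|v) = 1` and `μ` is unramified at `w` and
`c • w`, then `μ|_{𝕀_F}(ϖ_v) = μ(ϖ_w) μ(ϖ_{c • w})` (the places above `v` are `w`, `c • w`, and
`F_vˣ ↪ E_wˣ × E_{c w}ˣ` diagonally). [folklore] -/
theorem _root_.Literature.NumberTheory.GaloisRepresentations.HeckeCharacter.valueAtUniformizer_restrict_of_smul_ne
    (h2 : Module.finrank F E = 2) {c : E ≃ₐ[F] E} (hc : c ≠ 1) {μ : HeckeCharacter E}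
    {ψ : HeckeCharacter F} (hres : ∀ x, μ (AdeleRing.ideleBaseChange F E x) = ψ x)
    {w : HeightOneSpectrum (𝓞 E)} (hcw : c • w ≠ w) (he : w.asIdeal.ramificationIdx (𝓞 F) = 1)
    (hunr : μ.IsUnramifiedAt w) (hunr' : μ.IsUnramifiedAt (c • w)) :
    ψ.valueAtUniformizer (w.under (𝓞 F)) = μ.valueAtUniformizer w * μ.valueAtUniformizer (c • w) := by
  classical
  haveI : Algebra.IsQuadraticExtension F E := ⟨h2⟩
  haveI : IsGalois F E := inferInstance
  have hmem : ∀ w' : HeightOneSpectrum (𝓞 E), w'.under (𝓞 F) = w.under (𝓞 F) → w' = w ∨ w' = c • w :=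
    fun w' hw' => HeightOneSpectrum.eq_or_eq_smul_of_under_eq h2 hc hw'
  have hT : ∀ w' : HeightOneSpectrum (𝓞 E), w' ∈ ({w, c • w} : Finset (HeightOneSpectrum (𝓞 E))) ↔
      w'.under (𝓞 F) = w.under (𝓞 F) := fun w' => by
    rw [Finset.mem_insert, Finset.mem_singleton]
    refine ⟨?_, hmem w'⟩
    rintro (rfl | rfl)
    · rfl
    · exact HeightOneSpectrum.under_algEquiv_smul F E c w
  have he' : (c • w).asIdeal.ramificationIdx (𝓞 F) = 1 := by
    rw [HeightOneSpectrum.ramificationIdx_eq_ramificationIdxIn_under,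
      HeightOneSpectrum.under_algEquiv_smul F E c w,
      ← HeightOneSpectrum.ramificationIdx_eq_ramificationIdxIn_under, he]
  have heall : ∀ w' : HeightOneSpectrum (𝓞 E), w'.under (𝓞 F) = w.under (𝓞 F) →
      w'.asIdeal.ramificationIdx (𝓞 F) = 1 := fun w' hw' => by
    rcases hmem w' hw' with rfl | rfl
    · exact he
    · exact he'
  have hunrall : ∀ w' : HeightOneSpectrum (𝓞 E), w'.under (𝓞 F) = w.under (𝓞 F) →
      μ.IsUnramifiedAt w' := fun w' hw' => by
    rcases hmem w' hw' with rfl | rfl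
    · exact hunr
    · exact hunr'
  rw [HeckeCharacter.valueAtUniformizer_restrict (fun x => (hres x).symm) {w, c • w} hT heall hunrall,
    Finset.prod_pair fun h => hcw h.symm]

/-- **The class-field character at an inert unramified place of a quadratic extension is `-1`**:
for `η₀` vanishing exactly on `F^× N_{E/F} 𝕀_E` and `w` a `c`-fixed place of residue degree `2`
(so `e = 1`, `f = 2` below `w`), `η₀(ϖ_v) = -1` — it is a primitive square root of unity
(`IsClassFieldCharacter.valueAtUniformizer_ne_one_of_inert`, `valueAtUniformizer_pow_inertiaDegIn`:
Arthur–Clozel, Ch. 3, p. 201, "`ζ_v` is a root of unity of order `f_v`"). [cite: ArthurClozelAMS120, Ch. 3, proof of Thm. 3.1 (p. 201)]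
[cite: CasselsFrohlichANT1967, Ch. VII §5.1 Main Theorem (B)] -/
theorem _root_.Literature.NumberTheory.GaloisRepresentations.HeckeCharacter.IsClassFieldCharacter.valueAtUniformizer_under_eq_neg_one
    (h2 : Module.finrank F E = 2) {η₀ : HeckeCharacter F} (hη₀ : η₀.IsClassFieldCharacter E)
    {w : HeightOneSpectrum (𝓞 E)} (hf : w.asIdeal.inertiaDeg (𝓞 F) = 2) :
    η₀.valueAtUniformizer (w.under (𝓞 F)) = -1 := by
  haveI : Algebra.IsQuadraticExtension F E := ⟨h2⟩
  haveI : IsGalois F E := inferInstance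
  have hprime : (Module.finrank F E).Prime := by rw [h2]; exact Nat.prime_two
  obtain ⟨heIn, hfIn⟩ := HeightOneSpectrum.ramificationIdxIn_eq_one_of_inertiaDeg_eq_two h2 hf
  have hne : η₀.valueAtUniformizer (w.under (𝓞 F)) ≠ 1 :=
    hη₀.valueAtUniformizer_ne_one_of_inert hprime heIn (hfIn.trans h2.symm)
  have hsq : η₀.valueAtUniformizer (w.under (𝓞 F)) ^ 2 = 1 := by
    have h := hη₀.isTrivialOnNormGroup.valueAtUniformizer_pow_inertiaDegIn E (w.under (𝓞 F)) heIn
    rwa [hfIn] at h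
  rw [pow_two] at hsq
  exact (mul_self_eq_one_iff.1 hsq).resolve_left hne

/-- **A character trivial on the norm group is `1` at a uniformizer of a split place**: for `w` moved
by `c` (so `e = f = 1` below `w`), `ψ(ϖ_v) = 1`. [folklore] -/
theorem _root_.Literature.NumberTheory.GaloisRepresentations.HeckeCharacter.IsTrivialOnNormGroup.valueAtUniformizer_under_eq_one_of_smul_ne
    (h2 : Module.finrank F E = 2) {c : E ≃ₐ[F] E} {ψ : HeckeCharacter F} (hψ : ψ.IsTrivialOnNormGroup E)
    {w : HeightOneSpectrum (𝓞 E)} (hcw : c • w ≠ w) : ψ.valueAtUniformizer (w.under (𝓞 F)) = 1 := by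
  haveI : Algebra.IsQuadraticExtension F E := ⟨h2⟩
  haveI : IsGalois F E := inferInstance
  obtain ⟨heIn, hfIn⟩ := HeightOneSpectrum.ramificationIdxIn_eq_one_of_smul_ne h2 hcw
  have h := hψ.valueAtUniformizer_pow_inertiaDegIn E (w.under (𝓞 F)) heIn
  rwa [hfIn, pow_one] at h

end Values

/-! ### The Asai pole of the twist by `𝒵_E^-`: `L^S(s, P, As^η) = L^S(s, P ⊗ μ, As^{-η})` term by term -/

section AsaiTwist

variable {F E : Type} [Field F] [NumberField F] [Field E] [NumberField E] [Algebra F E]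
  {N : ℕ} {hcpt : isCompact_glFiniteIntegralLevel N E}

/-- **Twisting by a character over `ω_{E/F}` swaps the sign of the Asai pole**: `E/F` quadratic with
non-trivial automorphism `c`; `P'` the twist of `P` by `μ ∘ det` for a Hecke character `μ` of `E` with
`μ|_{𝕀_F} = η₀`, the class-field character of `E/F` (`η₀ = ω_{E/F}`; Mok's `μ ∈ 𝒵_E^-`), unramified at
every place of `E` unramified over `F`.  If `L^S(s, P, As^η)` has the pole at `s = 1⁺` at every Asai
datum (`HasAsaiPole c η`), then so does `L^S(s, P', As^{-η})`.  Proof, with NO analysis: an Asai datum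
`(S, A')` of `P'` gives the Asai datum `(S, μ(ϖ)⁻¹ A')` of `P` (`HasSatakeParamAt.of_heckeTwist`; above
`v ∉ S` every place is unramified over `F`, `HeightOneSpectrum.ramificationIdx_eq_one_of_asai`), and the
two partial products agree FACTOR BY FACTOR: twisting the Satake family by `t_w = μ(ϖ_w)⁻¹` composes the
local Asai polynomial with `X ↦ μ|_{F_vˣ}(ϖ_v)⁻¹ X` (`partialAsaiL_twist_eq_partialAsaiLTwist`), and
`μ|_{𝕀_F}(ϖ_v) = ω_{E/F}(ϖ_v)` is `-1` at an inert and `+1` at a split unramified `v`, which turns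
`As^η` into `As^{-η}` (`partialAsaiLTwist_quadraticSign`).  This is Mok's
"`L(s, φ^N, As⁻) = L(s, φ^N ⊗ χ_-, As⁺)` for `χ_- ∈ 𝒵_E^-`" (§2.5, arXiv p. 20; Gan–Gross–Prasad §7:
`As⁻ = As⁺ ⊗ ω_{E/F}`; Flicker 1988 p. 296, "replace `π` by its product with a character"), on the
tree's raw partial Euler products.
[cite: Mok2014, §2.5 (arXiv p. 20: L(s, φ^N, As⁻) = L(s, φ^N ⊗ χ_-, As⁺))] [cite: GanGrossPrasad2012, §7]
[cite: Flicker1988, p. 296] -/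
theorem AutomorphicRepData.HasAsaiPole.heckeTwist_neg (h2 : Module.finrank F E = 2) {c : E ≃ₐ[F] E}
    (hc : c ≠ 1) {P P' : AutomorphicRepData (AutomorphyDatum.gl N E hcpt)} {η : ℤˣ}
    (hP : P.HasAsaiPole c η) {μ : HeckeCharacter E} {η₀ : HeckeCharacter F}
    (hη₀ : η₀.IsClassFieldCharacter E) (hres : ∀ x, μ (AdeleRing.ideleBaseChange F E x) = η₀ x)
    (hunr : ∀ w : HeightOneSpectrum (𝓞 E), w.asIdeal.ramificationIdx (𝓞 F) = 1 → μ.IsUnramifiedAt w)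
    (hW : P'.W = P.W.map (mulChar (detTwist N μ))) (hW' : P'.W' = P.W'.map (mulChar (detTwist N μ))) :
    P'.HasAsaiPole c (-η) := by
  intro S A' hA'
  -- above the complement of `S` every place is unramified over `F`, so `μ` is unramified there
  have he : ∀ w : HeightOneSpectrum (𝓞 E), w.under (𝓞 F) ∉ S → w.asIdeal.ramificationIdx (𝓞 F) = 1 :=
    fun w hw => HeightOneSpectrum.ramificationIdx_eq_one_of_asai h2 (hA'.inertiaDeg_eq_two hw)
  have hμ : ∀ w : HeightOneSpectrum (𝓞 E), w.under (𝓞 F) ∉ S → μ.IsUnramifiedAt w :=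
    fun w hw => hunr w (he w hw)
  have hμc : ∀ w : HeightOneSpectrum (𝓞 E), w.under (𝓞 F) ∉ S → μ.IsUnramifiedAt (c • w) :=
    fun w hw => hμ (c • w) (by rwa [HeightOneSpectrum.under_algEquiv_smul F E c w])
  -- the transported Asai datum of `P`
  set t : HeightOneSpectrum (𝓞 E) → ℂ := fun w => (μ.valueAtUniformizer w)⁻¹ with ht
  have hA : P.IsAsaiDatum c S (fun w => (A' w).map (t w * ·)) :=
    ⟨hA'.finite, fun w hw => (hA'.hasSatakeParamAt hw).of_heckeTwist μ (hμ w hw) hW hW',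
      fun w hw hcw => hA'.inertiaDeg_eq_two hw hcw⟩
  obtain ⟨r, hr, hlim⟩ := hP hA
  refine ⟨r, hr, ?_⟩
  -- the two partial products agree term by term
  have heq : ∀ s : ℂ, partialAsaiL S c (fun w => (A' w).map (t w * ·)) η s = partialAsaiL S c A' (-η) s := by
    intro s
    rw [partialAsaiL_twist_eq_partialAsaiLTwist S c A' t (m := fun v => (η₀.valueAtUniformizer v)⁻¹)
        (fun w hw hcw => by
          rw [ht, HeckeCharacter.valueAtUniformizer_restrict_of_smul_eq h2 hc hres hcw (he w hw)
            (hμ w hw)])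
        (fun w hw hcw => by
          rw [ht, HeckeCharacter.valueAtUniformizer_restrict_of_smul_ne h2 hc hres hcw (he w hw)
            (hμ w hw) (hμc w hw), mul_inv])
        η s,
      partialAsaiLTwist_quadraticSign S c A'
        (fun w hw hcw => by
          rw [hη₀.valueAtUniformizer_under_eq_neg_one h2 (hA'.inertiaDeg_eq_two hw hcw)]
          norm_num)
        (fun w _ hcw => by
          rw [hη₀.isTrivialOnNormGroup.valueAtUniformizer_under_eq_one_of_smul_ne h2 hcw, inv_one])
        η s]
  simpa only [heq] using hlim

/-- **Twisting by a character over `1` (Mok's `𝒵_E^+`) preserves the Asai pole**: same setting as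
`HasAsaiPole.heckeTwist_neg` but with `μ|_{𝕀_F} = 1`; then `L^S(s, P ⊗ μ, As^η) = L^S(s, P, As^η)`
factor by factor (`μ(ϖ_w) = 1` at inert `w`, `μ(ϖ_w) μ(ϖ_{c w}) = 1` at split ones), so `HasAsaiPole c η`
passes to the twist — the case `κ' = +1` of Mok's signature calculus (§2.1, last diagram, arXiv pp. 7–8).
[cite: Mok2014, §2.1 (last diagram) and §2.5, arXiv pp. 7–8, 20] [cite: Flicker1988, p. 296] -/
theorem AutomorphicRepData.HasAsaiPole.heckeTwist_pos (h2 : Module.finrank F E = 2) {c : E ≃ₐ[F] E}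
    (hc : c ≠ 1) {P P' : AutomorphicRepData (AutomorphyDatum.gl N E hcpt)} {η : ℤˣ}
    (hP : P.HasAsaiPole c η) {μ : HeckeCharacter E}
    (hres : ∀ x, μ (AdeleRing.ideleBaseChange F E x) = (1 : HeckeCharacter F) x)
    (hunr : ∀ w : HeightOneSpectrum (𝓞 E), w.asIdeal.ramificationIdx (𝓞 F) = 1 → μ.IsUnramifiedAt w)
    (hW : P'.W = P.W.map (mulChar (detTwist N μ))) (hW' : P'.W' = P.W'.map (mulChar (detTwist N μ))) :
    P'.HasAsaiPole c η := by
  intro S A' hA'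
  have he : ∀ w : HeightOneSpectrum (𝓞 E), w.under (𝓞 F) ∉ S → w.asIdeal.ramificationIdx (𝓞 F) = 1 :=
    fun w hw => HeightOneSpectrum.ramificationIdx_eq_one_of_asai h2 (hA'.inertiaDeg_eq_two hw)
  have hμ : ∀ w : HeightOneSpectrum (𝓞 E), w.under (𝓞 F) ∉ S → μ.IsUnramifiedAt w :=
    fun w hw => hunr w (he w hw)
  have hμc : ∀ w : HeightOneSpectrum (𝓞 E), w.under (𝓞 F) ∉ S → μ.IsUnramifiedAt (c • w) :=
    fun w hw => hμ (c • w) (by rwa [HeightOneSpectrum.under_algEquiv_smul F E c w])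
  have h1 : ∀ v : HeightOneSpectrum (𝓞 F), (1 : HeckeCharacter F).valueAtUniformizer v = 1 := fun v => by
    rw [HeckeCharacter.valueAtUniformizer, HeckeCharacter.localComponent_apply,
      HeckeCharacter.one_apply, Units.val_one]
  set t : HeightOneSpectrum (𝓞 E) → ℂ := fun w => (μ.valueAtUniformizer w)⁻¹ with ht
  have hA : P.IsAsaiDatum c S (fun w => (A' w).map (t w * ·)) :=
    ⟨hA'.finite, fun w hw => (hA'.hasSatakeParamAt hw).of_heckeTwist μ (hμ w hw) hW hW',
      fun w hw hcw => hA'.inertiaDeg_eq_two hw hcw⟩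
  obtain ⟨r, hr, hlim⟩ := hP hA
  refine ⟨r, hr, ?_⟩
  have heq : ∀ s : ℂ, partialAsaiL S c (fun w => (A' w).map (t w * ·)) η s = partialAsaiL S c A' η s := by
    intro s
    rw [partialAsaiL_twist_eq_partialAsaiLTwist S c A' t (m := fun _ => 1)
        (fun w hw hcw => by
          change (1 : ℂ) = (μ.valueAtUniformizer w)⁻¹
          rw [← HeckeCharacter.valueAtUniformizer_restrict_of_smul_eq h2 hc hres hcw (he w hw)
            (hμ w hw), h1, inv_one])
        (fun w hw hcw => by
          change (1 : ℂ) = (μ.valueAtUniformizer w)⁻¹ * (μ.valueAtUniformizer (c • w))⁻¹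
          rw [← mul_inv, ← HeckeCharacter.valueAtUniformizer_restrict_of_smul_ne h2 hc hres hcw
            (he w hw) (hμ w hw) (hμc w hw), h1, inv_one])
        η s,
      partialAsaiLTwist_eq_partialAsaiL_of_eq_one c A' (fun _ _ => rfl) η s]
  simpa only [heq] using hlim

/-- **Mok's signature rule `κ ↦ κ κ'` for `κ' = -1`, on the tree's raw Asai signs**: twisting a
representation of Asai sign `κ` (`HasAsaiSign c κ`: `L^S(s, P, As^{(-1)^{N-1} κ})` has the pole) by a
character over `ω_{E/F}` gives Asai sign `-κ` (any parity of `N`).  Mok, §2.1, last diagram and the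
sentence after it (arXiv pp. 7–8): "the signature of `χ̃` is given by `κ' κ_i`".
[cite: Mok2014, §2.1 (last diagram), arXiv pp. 7–8] [cite: GanGrossPrasad2012, §7] -/
theorem AutomorphicRepData.HasAsaiSign.heckeTwist_neg (h2 : Module.finrank F E = 2) {c : E ≃ₐ[F] E}
    (hc : c ≠ 1) {P P' : AutomorphicRepData (AutomorphyDatum.gl N E hcpt)} {κ : ℤˣ}
    (hP : P.HasAsaiSign c κ) {μ : HeckeCharacter E} {η₀ : HeckeCharacter F}
    (hη₀ : η₀.IsClassFieldCharacter E) (hres : ∀ x, μ (AdeleRing.ideleBaseChange F E x) = η₀ x)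
    (hunr : ∀ w : HeightOneSpectrum (𝓞 E), w.asIdeal.ramificationIdx (𝓞 F) = 1 → μ.IsUnramifiedAt w)
    (hW : P'.W = P.W.map (mulChar (detTwist N μ))) (hW' : P'.W' = P.W'.map (mulChar (detTwist N μ))) :
    P'.HasAsaiSign c (-κ) := by
  rw [AutomorphicRepData.hasAsaiSign_iff] at hP ⊢
  rw [mul_neg]
  exact hP.heckeTwist_neg h2 hc hη₀ hres hunr hW hW'

/-- **Signature rule for `κ' = +1`**: twisting by a character over `1` (`𝒵_E^+`) preserves the raw Asai
sign. [cite: Mok2014, §2.1 (last diagram), arXiv pp. 7–8] -/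
theorem AutomorphicRepData.HasAsaiSign.heckeTwist_pos (h2 : Module.finrank F E = 2) {c : E ≃ₐ[F] E}
    (hc : c ≠ 1) {P P' : AutomorphicRepData (AutomorphyDatum.gl N E hcpt)} {κ : ℤˣ}
    (hP : P.HasAsaiSign c κ) {μ : HeckeCharacter E}
    (hres : ∀ x, μ (AdeleRing.ideleBaseChange F E x) = (1 : HeckeCharacter F) x)
    (hunr : ∀ w : HeightOneSpectrum (𝓞 E), w.asIdeal.ramificationIdx (𝓞 F) = 1 → μ.IsUnramifiedAt w)
    (hW : P'.W = P.W.map (mulChar (detTwist N μ))) (hW' : P'.W' = P.W'.map (mulChar (detTwist N μ))) :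
    P'.HasAsaiSign c κ := by
  rw [AutomorphicRepData.hasAsaiSign_iff] at hP ⊢
  exact hP.heckeTwist_pos h2 hc hres hunr hW hW'

end AsaiTwist

/-! ### Characters of `𝕀_E` over `ω_{E/F}` (Mok's `𝒵_E^- ≠ ∅`): from the extension fact, and
unconditionally in the CM case -/

section Existence

/-- **`𝒵_E^-` is non-empty, from the extension fact**: granted
`HewittRoss_heckeCharacter_extension_quadratic` (Hewitt–Ross (24.12): unitary idele class characters
extend along `C_F ↪ C_E` with prescribed unramifiedness on a `c`-admissible set), for every quadratic
`E/F` with `c ≠ 1` there are the class-field character `η₀ = ω_{E/F}` of `F`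
(`exists_isClassFieldCharacter_holds`) and a unitary Hecke character `μ` of `E` with `μ|_{𝕀_F} = η₀` which
is unramified at every place of `E` unramified over `F` (admissibility: `η₀` is unramified at the places
unramified in `E`, `IsTrivialOnNormGroup.isUnramifiedAt_of_ramificationIdxIn_eq_one`) — a character
`χ_- ∈ 𝒵_E^-` of Mok, §2.1 (arXiv p. 7: "when `κ = -1`, there is no canonical choice of `χ_-`").
[cite: Mok2014, §2.1, arXiv p. 7] [cite: HewittRoss1979, Thm. (24.12)] -/
theorem exists_heckeCharacter_restrict_eq_classFieldCharacter
    (hext : HewittRoss_heckeCharacter_extension_quadratic)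
    (F E : Type) [Field F] [NumberField F] [Field E] [NumberField E] [Algebra F E] (c : E ≃ₐ[F] E)
    (h2 : Module.finrank F E = 2) (hc : c ≠ 1) :
    ∃ (η₀ : HeckeCharacter F) (μ : HeckeCharacter E), η₀.IsClassFieldCharacter E ∧ μ.IsUnitary ∧
      (∀ x, μ (AdeleRing.ideleBaseChange F E x) = η₀ x) ∧
      ∀ w : HeightOneSpectrum (𝓞 E), w.asIdeal.ramificationIdx (𝓞 F) = 1 → μ.IsUnramifiedAt w := by
  haveI : FiniteDimensional F E := Module.finite_of_finrank_eq_succ h2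
  haveI : Algebra.IsQuadraticExtension F E := ⟨h2⟩
  haveI : IsGalois F E := inferInstance
  have hprime : (Module.finrank F E).Prime := by rw [h2]; exact Nat.prime_two
  haveI : Fact (Module.finrank F E).Prime := ⟨hprime⟩
  haveI : IsCyclic (E ≃ₐ[F] E) := isCyclic_of_prime_card (IsGalois.card_aut_eq_finrank F E)
  obtain ⟨η₀, hη₀, -⟩ := exists_isClassFieldCharacter_holds (F := F) (E := E)
  set U : Set (HeightOneSpectrum (𝓞 E)) := {w | w.asIdeal.ramificationIdx (𝓞 F) = 1} with hU
  have hUadm : ∀ u ∈ U, c • u ∈ U → η₀.IsUnramifiedAt (u.under (𝓞 F)) := fun u hu _ =>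
    hη₀.isTrivialOnNormGroup.isUnramifiedAt_of_ramificationIdxIn_eq_one hprime
      (by rw [← HeightOneSpectrum.ramificationIdx_eq_ramificationIdxIn_under]; exact hu)
  obtain ⟨μ, hμu, hres, hunr⟩ := hext F E c h2 hc η₀ hη₀.isUnitary U hUadm
  exact ⟨η₀, μ, hη₀, hμu, hres, fun w hw => hunr w hw⟩

/-- **`𝒵_E^-` is non-empty in the CM case, unconditionally**: for `F` totally real and `E` a totally
complex quadratic extension with `c ≠ 1`, there are the class-field character `η₀ = ω_{E/F}` and a unitary
Hecke character `μ` of `E` with `μ|_{𝕀_F} = η₀`, unramified at every place of `E` unramified over `F` — by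
the tree's theorem `HeckeCharacter.exists_extension_quadratic_of_isTotallyComplex_of_isFiniteOrder`
(Weil's extension method; `η₀` has finite order).  [cite: Mok2014, §2.1, arXiv p. 7] [cite: Weil1956, §1] -/
theorem exists_heckeCharacter_restrict_eq_classFieldCharacter_of_isTotallyComplex
    (F E : Type) [Field F] [NumberField F] [Field E] [NumberField E] [Algebra F E] (c : E ≃ₐ[F] E)
    (h2 : Module.finrank F E = 2) (hc : c ≠ 1) (hTR : IsTotallyReal F) (hTC : IsTotallyComplex E) :
    ∃ (η₀ : HeckeCharacter F) (μ : HeckeCharacter E), η₀.IsClassFieldCharacter E ∧ μ.IsUnitary ∧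
      (∀ x, μ (AdeleRing.ideleBaseChange F E x) = η₀ x) ∧
      ∀ w : HeightOneSpectrum (𝓞 E), w.asIdeal.ramificationIdx (𝓞 F) = 1 → μ.IsUnramifiedAt w := by
  haveI : FiniteDimensional F E := Module.finite_of_finrank_eq_succ h2
  haveI : Algebra.IsQuadraticExtension F E := ⟨h2⟩
  haveI : IsGalois F E := inferInstance
  have hprime : (Module.finrank F E).Prime := by rw [h2]; exact Nat.prime_two
  haveI : Fact (Module.finrank F E).Prime := ⟨hprime⟩
  haveI : IsCyclic (E ≃ₐ[F] E) := isCyclic_of_prime_card (IsGalois.card_aut_eq_finrank F E)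
  obtain ⟨η₀, hη₀, -⟩ := exists_isClassFieldCharacter_holds (F := F) (E := E)
  set U : Set (HeightOneSpectrum (𝓞 E)) := {w | w.asIdeal.ramificationIdx (𝓞 F) = 1} with hU
  have hUadm : ∀ u ∈ U, c • u ∈ U → η₀.IsUnramifiedAt (u.under (𝓞 F)) := fun u hu _ =>
    hη₀.isTrivialOnNormGroup.isUnramifiedAt_of_ramificationIdxIn_eq_one hprime
      (by rw [← HeightOneSpectrum.ramificationIdx_eq_ramificationIdxIn_under]; exact hu)
  obtain ⟨μ, hμu, hres, hunr⟩ :=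
    HeckeCharacter.exists_extension_quadratic_of_isTotallyComplex_of_isFiniteOrder F E c h2 hc hTR hTC
      η₀ hη₀.isFiniteOrder U hUadm
  exact ⟨η₀, μ, hη₀, hμu, hres, fun w hw => hunr w hw⟩

end Existence

/-! ### The centre under an `As⁻` pole: `ω_P|_{𝕀_F} = ω_{E/F}` for odd `N` (via the twist and the
standard descent) -/

section CentreNeg

variable {F E : Type} [Field F] [NumberField F] [Field E] [NumberField E] [Algebra F E]
  {N : ℕ} {hcpt : isCompact_glFiniteIntegralLevel N E}

/-- **For odd `N`, an `As⁻` pole forces `ω_P|_{𝕀_F} = ω_{E/F}`**, granted the standard descent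
`Mok2014_standardBaseChange_descent` and a character `μ` of `𝕀_E` over the class-field character `η₀`
unramified at the places unramified over `F` (`𝒵_E^- ≠ ∅`).  For `P` cuspidal on `GL_N(𝔸_E)`,
conjugate self-dual a.e., with `HasAsaiSign c (-1)` (i.e. `L^S(s, P, As⁻)` has the pole at `1⁺`, `N`
odd) and `ω` carrying the Satake shadow of its central character: the twist `P' = P ⊗ (μ ∘ det)`
(`exists_cuspidalAutomorphicRepData_twist_hecke`) is cuspidal, conjugate self-dual a.e.
(`IsConjSelfDualAE.heckeTwist`) and has `HasAsaiSign c 1` (`HasAsaiPole.heckeTwist_neg`: Mok's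
`L(s, P, As⁻) = L(s, P ⊗ χ_-, As⁺)`), so by the descent it is a standard weak base change from
`U_{E/F}(N)` and its central character `ω' = μ^N ω` (`centralCharacter_heckeTwist_eq`) is trivial on `𝕀_F`
(`restrict_centralCharacter_eq_one_of_isWeakBaseChange`); hence `ω|_{𝕀_F} = η₀^{-N} = η₀` (`η₀² = 1`, `N`
odd).  This is the centre of "`κ = -1` iff `P` descends via the twisted base change `ξ_{χ_-}`"
(Mok, Thm. 2.5.4 (a) and the Remark after it, arXiv p. 21: "with a similar result for the twisted base
change"), obtained from the standard case by Mok's device of twisting by `χ_- ∈ 𝒵_E^-` (§2.1 last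
diagram; §2.5 p. 20). [cite: Mok2014, Thm. 2.4.2, Thm. 2.5.4 (a) and the following Remark, §2.5 (arXiv pp. 13, 20–21)]
[cite: GanGrossPrasad2012, Lemma 3.4 (ℂ(χ) conjugate-symplectic iff χ|_{k₀ˣ} = ω, non-trivial on k₀ˣ but trivial on norms)] -/
theorem CuspidalAutomorphicRepData.restrict_centralCharacter_eq_of_hasAsaiSign_neg_one
    (hdesc : Mok2014_standardBaseChange_descent)
    (h2 : Module.finrank F E = 2) {c : E ≃ₐ[F] E} (hc : c ≠ 1) (hN : Odd N)
    (P : CuspidalAutomorphicRepData N E hcpt) (hcsd : P.1.IsConjSelfDualAE c)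
    (hsign : P.1.HasAsaiSign c (-1))
    {μ : HeckeCharacter E} {η₀ : HeckeCharacter F} (hη₀ : η₀.IsClassFieldCharacter E)
    (hres : ∀ x, μ (AdeleRing.ideleBaseChange F E x) = η₀ x)
    (hunr : ∀ w : HeightOneSpectrum (𝓞 E), w.asIdeal.ramificationIdx (𝓞 F) = 1 → μ.IsUnramifiedAt w)
    {ω : HeckeCharacter E}
    (hωs : ∀ {w : HeightOneSpectrum (𝓞 E)} {α : Multiset ℂ}, P.1.HasSatakeParamAt w α →
      ω.IsUnramifiedAt w ∧ ω.valueAtUniformizer w = α.prod)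
    {ψ : HeckeCharacter F} (hψ : ∀ x, ψ x = ω (AdeleRing.ideleBaseChange F E x)) : ψ = η₀ := by
  haveI : NeZero N := ⟨hN.pos.ne'⟩
  haveI : FiniteDimensional F E := Module.finite_of_finrank_eq_succ h2
  haveI : Algebra.IsQuadraticExtension F E := ⟨h2⟩
  haveI : IsGalois F E := inferInstance
  -- the twist `P' = P ⊗ (μ ∘ det)`: cuspidal, conjugate self-dual, with an `As⁺` pole
  obtain ⟨P', hW, hW'⟩ := exists_cuspidalAutomorphicRepData_twist_hecke μ P
  have hdual : ∀ y : ideleGroup E, μ (c • y) * μ y = 1 :=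
    HeckeCharacter.apply_smul_mul_eq_one_of_restrict h2 hc hres hη₀.isTrivialOnNormGroup
  have hcsd' : P'.1.IsConjSelfDualAE c := hcsd.heckeTwist hdual hW hW'
  have hpole : P.1.HasAsaiPole c (-1) := (P.1.hasAsaiSign_iff_of_odd hN c (-1)).1 hsign
  have hpole' : P'.1.HasAsaiPole c 1 := by
    have h := hpole.heckeTwist_neg h2 hc hη₀ hres hunr hW hW'
    rwa [neg_neg] at h
  have hsign' : P'.1.HasAsaiSign c 1 := (P'.1.hasAsaiSign_iff_of_odd hN c 1).2 hpole'
  -- the standard descent of the twist, and the centre of a standard weak base change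
  obtain ⟨π, hBC⟩ := hdesc F E c h2 hc N hcpt P' hN.pos hcsd' hsign'
  obtain ⟨ω', -, hω's⟩ := P'.1.exists_centralCharacter
  obtain ⟨ψ', hψ'⟩ := ω'.exists_restrict F
  have hψ'1 : ψ' = 1 :=
    P'.1.restrict_centralCharacter_eq_one_of_isWeakBaseChange h2 hc (fun h => hω's h) hcsd' hBC hψ'
  have hωω' : ω' = μ ^ N * ω :=
    AutomorphicRepData.centralCharacter_heckeTwist_eq (fun h => hωs h) (fun h => hω's h) μ hW hW'
  -- restrict to `𝕀_F`: `1 = η₀^N ψ`, with `η₀² = 1` and `N` odd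
  have hcard : Fintype.card (E ≃ₐ[F] E) = 2 := by
    rw [← Nat.card_eq_fintype_card, IsGalois.card_aut_eq_finrank, h2]
  refine HeckeCharacter.ext fun x => ?_
  have hx : ψ' x = (1 : HeckeCharacter F) x := by rw [hψ'1]
  rw [hψ', hωω', HeckeCharacter.mul_apply, HeckeCharacter.pow_apply, hres, ← hψ,
    HeckeCharacter.one_apply] at hx
  have hη₀x : η₀ x * η₀ x = 1 := by
    have h := hη₀.isTrivialOnNormGroup.apply_pow_card x
    rwa [hcard, pow_two] at h
  obtain ⟨n, rfl⟩ := hN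
  have hpow : η₀ x ^ (2 * n + 1) = η₀ x := by
    rw [pow_succ, pow_mul, pow_two, hη₀x, one_pow, one_mul]
  rw [hpow] at hx
  rw [eq_inv_of_mul_eq_one_right hx, inv_eq_of_mul_eq_one_right hη₀x]

end CentreNeg

/-! ### The fact for odd `N` and `κ = -1` -/

section OddNegative

variable {F E : Type} [Field F] [NumberField F] [Field E] [NumberField E] [Algebra F E]
  {N : ℕ} {hcpt : isCompact_glFiniteIntegralLevel N E}

/-- **An archimedean parameter on `GL_N` has `N` entries at every complex embedding** (local copy of
`AutomorphicRepData.card_eq_of_hasArchParameter`, as in `AsaiSignArchParityCentre`, to keep the imports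
light). Clozel 1990, §3.3. [cite: Clozel1990, §3.3] -/
private theorem card_eq_of_hasArchParameter' {π : AutomorphicRepData (AutomorphyDatum.gl N E hcpt)}
    {χ : (E →+* ℂ) → Multiset ℂ} (h : π.HasArchParameter χ) (σ : E →+* ℂ) :
    Multiset.card (χ σ) = N := by
  obtain ⟨ρ, -, hre, hco⟩ := h
  rcases (InfinitePlace.mk σ).isReal_or_isComplex with hw | hw
  · have h1 := (hre ⟨InfinitePlace.mk σ, hw⟩).1 (Algebra.ofId ℝ ℂ)
    dsimp only at h1
    rwa [embedding_mk_eq_of_isReal (isReal_mk_iff.mp hw)] at h1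
  · rcases InfinitePlace.mk_eq_iff.mp (InfinitePlace.mk_embedding (InfinitePlace.mk σ)) with hσ | hσ
    · have h1 := (hco ⟨InfinitePlace.mk σ, hw⟩).1 (AlgHom.id ℝ ℂ)
      dsimp only at h1
      rwa [algHomId_toRingHom_comp, hσ] at h1
    · have h1 := (hco ⟨InfinitePlace.mk σ, hw⟩).1 (Complex.conjAe : ℂ →ₐ[ℝ] ℂ)
      dsimp only at h1
      rwa [conjAe_toRingHom_comp, hσ] at h1

/-- A multiset of (complex numbers that are) integers has an integer sum. [folklore] -/
private theorem exists_int_multiset_sum' {S : Multiset ℂ} (h : ∀ x ∈ S, ∃ m : ℤ, x = m) :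
    ∃ M : ℤ, S.sum = M := by
  induction S using Multiset.induction_on with
  | empty => exact ⟨0, by simp⟩
  | cons a S ih =>
    obtain ⟨m, hm⟩ := h a (Multiset.mem_cons_self a S)
    obtain ⟨M, hM⟩ := ih fun x hx => h x (Multiset.mem_cons_of_mem hx)
    exact ⟨m + M, by rw [Multiset.sum_cons, hm, hM, Int.cast_add]⟩

omit [NumberField F] in
/-- **`2r ∈ ℤ` from an infinity type.**  For a conjugate self-dual cuspidal `P` on `GL_N(𝔸_E)`, `N ≥ 1`,
with an infinity type (`AutomorphicRepData.exists_hasInfinityType`, Clozel 1990 §3.3: an integral pairing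
of the exponents at `σ` and `σ̄`) and exponents `χ σ ⊆ r + ℤ` at a `c`-conjugation embedding `σ`:
`2r ∈ ℤ` (an exponent `a ∈ r + ℤ` is paired with some `b`, `a - b ∈ ℤ`, and
`b ∈ χ(σ̄) = -conj χ(σ) ⊆ -r + ℤ` by Clozel's symmetry with shift `0`,
`archParameter_conjugate_eq_map_neg_conj_of_isConjSelfDualAE`). [cite: Clozel1990, §3.3 and Lemme 4.9] -/
theorem CuspidalAutomorphicRepData.exists_int_two_mul_of_coset {c : E ≃ₐ[F] E} (hc : c ≠ 1) (hN : 0 < N)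
    (P : CuspidalAutomorphicRepData N E hcpt) (hcsd : P.1.IsConjSelfDualAE c)
    (hex : P.1.exists_hasInfinityType) {χ : (E →+* ℂ) → Multiset ℂ} (hχ : P.1.HasArchParameter χ)
    {σ : E →+* ℂ} (hσ : NumberField.ComplexEmbedding.IsConj σ c) {r : ℝ}
    (hcos : ∀ a ∈ χ σ, ∃ m : ℤ, a = (m : ℂ) + (r : ℂ)) : ∃ k : ℤ, 2 * r = k := by
  haveI : NeZero N := ⟨hN.ne'⟩
  -- the place `w₀` of `σ`: complex, fixed by `c`
  have hram : ¬ IsUnramified F (InfinitePlace.mk σ) := fun h => hc (hσ.isUnramified_mk_iff.1 h)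
  have hw : (InfinitePlace.mk σ).IsComplex := (not_isUnramified_iff.1 hram).1
  set w₀ : {w : InfinitePlace E // w.IsComplex} := ⟨InfinitePlace.mk σ, hw⟩ with hw₀
  have hcw : c • w₀.1 = w₀.1 :=
    MulAction.mem_stabilizer_iff.1 ((NumberField.InfinitePlace.mem_stabilizer_mk_iff σ c).2 (Or.inr hσ))
  have hsymm : χ (ComplexEmbedding.conjugate σ) = (χ σ).map fun a => -conj a :=
    P.archParameter_conjugate_eq_map_neg_conj_of_isConjSelfDualAE hc hcsd hχ w₀ hcw σ
  obtain ⟨T, hTwf, hTχ⟩ := hex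
  have hχT : χ = fun ι => (T ι).map ArchWeight.a := P.1.hasArchParameter_unique hχ hTχ
  have hcardσ : Multiset.card (χ σ) = N := by rw [hχT, Multiset.card_map, hTwf.1 σ]
  obtain ⟨a, ha⟩ : ∃ a, a ∈ χ σ := Multiset.card_pos_iff_exists_mem.mp (hcardσ ▸ hN)
  obtain ⟨m, hm⟩ := hcos a ha
  obtain ⟨wt, hwt, hwta⟩ : ∃ wt ∈ T σ, wt.a = a := by
    rw [hχT] at ha
    exact Multiset.mem_map.1 ha
  have hb : wt.b ∈ χ (ComplexEmbedding.conjugate σ) := by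
    rw [hχT]
    change wt.b ∈ (T (ComplexEmbedding.conjugate σ)).map ArchWeight.a
    rw [hTwf.2 σ, Multiset.map_map]
    exact Multiset.mem_map.2 ⟨wt, hwt, rfl⟩
  rw [hsymm] at hb
  obtain ⟨a', ha', hba'⟩ := Multiset.mem_map.1 hb
  obtain ⟨m', hm'⟩ := hcos a' ha'
  obtain ⟨m₁, hm₁⟩ := wt.exists_int_sub
  refine ⟨m₁ - m - m', ?_⟩
  have h2r : (2 : ℂ) * r = ((m₁ - m - m' : ℤ) : ℂ) := by
    rw [hwta, ← hba', hm, hm', map_add, Complex.conj_ofReal, map_intCast] at hm₁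
    push_cast
    linear_combination hm₁
  exact_mod_cast h2r

/-- **Mok's archimedean parity of the Asai sign for odd `N` and `κ = -1` — the centre of Cor. 2.5.5 in
the conjugate-symplectic case, with `2r ∈ ℤ`.**  `E/F` quadratic with non-trivial automorphism `c`, `N`
odd, `P` a cuspidal automorphic representation datum of `GL_N(𝔸_E)` conjugate self-dual almost everywhere
with `HasAsaiSign c (-1)` (the raw partial product `L^S(s, P, As⁻)` has the pole at `s = 1⁺` at every
Asai datum), `χ` its archimedean parameter and `σ : E → ℂ` an embedding on which `c` is complex
conjugation; granted the standard descent `Mok2014_standardBaseChange_descent` (Mok, Thm. 2.4.2 with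
Thm. 2.5.4 (a)) and a character `μ` of `𝕀_E` over the class-field character `η₀ = ω_{E/F}` unramified at the
places unramified over `F` (`χ_- ∈ 𝒵_E^-`).  If the exponents `χ σ` lie in one real coset `r + ℤ` with
`2r ∈ ℤ`, then every exponent lies in `1/2 + ℤ = (N-1)/2 + (1-κ)/4 + ℤ` (`κ = -1`, `N` odd) — the
conclusion of `Mok2014_archimedean_parity_of_asaiSign`, with no regularity hypothesis.  Proof: the
central character `ω` of `P` restricts to `ω|_{𝕀_F} = η₀ ≠ 1`
(`restrict_centralCharacter_eq_of_hasAsaiSign_neg_one`: twist by `μ`, descend, read the centre), so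
`∑ χ(σ) ∈ 1/2 + ℤ` (`sum_archParameter_int_or_half_of_isConjSelfDualAE`: `e^{2πi ∑ χ(σ)} = ω((-1)_w) =
ω_{E/F, v}(-1) = -1`); with `card χ(σ) = N` this is `N r ∈ 1/2 + ℤ`, and `r = N r - ((N-1)/2)(2r) ∈ 1/2 + ℤ`.
(Mok's proof of Cor. 2.5.5 instead reads the parity `(-1)^{2 a_i} = (-1)^{N-1} κ` off Thm. 2.4.10 at
`v`; for odd `N` its determinant — Gan–Gross–Prasad: `det` of a conjugate self-dual parameter of sign `b`
and odd dimension has sign `b` — carries the same information, and the twist by `χ_-` reduces `κ = -1` to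
the standard descent.) [cite: Mok2014, Cor. 2.5.5 with Thm. 2.4.2, Thm. 2.5.4 (a) and the following Remark, §2.1 and §2.5 (arXiv pp. 7, 13, 20–21)]
[cite: GanGrossPrasad2012, §3 (paragraph before Lemma 3.4: det M is conjugate-dual of sign b^dim M) and Lemma 3.4] -/
theorem Mok2014_archimedean_parity_of_asaiSign_odd_neg_of_heckeCharacter_of_two_mul
    (hdesc : Mok2014_standardBaseChange_descent)
    (h2 : Module.finrank F E = 2) {c : E ≃ₐ[F] E} (hc : c ≠ 1) (hN : Odd N)
    (P : CuspidalAutomorphicRepData N E hcpt) (hcsd : P.1.IsConjSelfDualAE c)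
    (hsign : P.1.HasAsaiSign c (-1))
    {μ : HeckeCharacter E} {η₀ : HeckeCharacter F} (hη₀ : η₀.IsClassFieldCharacter E)
    (hres : ∀ x, μ (AdeleRing.ideleBaseChange F E x) = η₀ x)
    (hunr : ∀ w : HeightOneSpectrum (𝓞 E), w.asIdeal.ramificationIdx (𝓞 F) = 1 → μ.IsUnramifiedAt w)
    {χ : (E →+* ℂ) → Multiset ℂ} (hχ : P.1.HasArchParameter χ)
    {σ : E →+* ℂ} (hσ : NumberField.ComplexEmbedding.IsConj σ c) {r : ℝ}
    (hcos : ∀ a ∈ χ σ, ∃ m : ℤ, a = (m : ℂ) + (r : ℂ)) (h2r : ∃ k : ℤ, 2 * r = k) :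
    ∀ a ∈ χ σ, ∃ m : ℤ, a = (m : ℂ) + ((N : ℂ) - 1) / 2 + 1 / 2 := by
  haveI : FiniteDimensional F E := Module.finite_of_finrank_eq_succ h2
  haveI : Algebra.IsQuadraticExtension F E := ⟨h2⟩
  haveI : IsGalois F E := inferInstance
  have hprime : (Module.finrank F E).Prime := by rw [h2]; exact Nat.prime_two
  haveI : Fact (Module.finrank F E).Prime := ⟨hprime⟩
  haveI : IsCyclic (E ≃ₐ[F] E) := isCyclic_of_prime_card (IsGalois.card_aut_eq_finrank F E)
  -- the centre: `ω|_{𝕀_F} = η₀ ≠ 1`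
  obtain ⟨ω, hωc, hωs⟩ := P.1.exists_centralCharacter
  obtain ⟨ψ, hψ⟩ := ω.exists_restrict F
  have hψη : ψ = η₀ := P.restrict_centralCharacter_eq_of_hasAsaiSign_neg_one hdesc h2 hc hN hcsd hsign
    hη₀ hres hunr (fun h => hωs h) hψ
  have hη₀1 : η₀ ≠ 1 := by
    have hidx : (normGroup F E).index = 2 :=
      (index_normGroup_eq_finrank_of_isCyclic (F := F) (E := E)).trans h2
    obtain ⟨x₀, hx₀⟩ := Subgroup.index_eq_two_iff.1 hidx
    have hx₀N : x₀ ∉ normGroup F E := by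
      rcases hx₀ 1 with ⟨-, h⟩ | ⟨-, h⟩
      · exact absurd (one_mem _) h
      · rwa [one_mul] at h
    exact hη₀.ne_one hx₀N
  obtain ⟨-, -, hhalf⟩ :=
    P.1.sum_archParameter_int_or_half_of_isConjSelfDualAE h2 hc hωc (fun h => hωs h) hcsd hψ hχ hσ
  obtain ⟨k, hk⟩ := hhalf (hψη ▸ hη₀1)
  -- `N r ∈ 1/2 + ℤ`
  have hcardσ : Multiset.card (χ σ) = N := card_eq_of_hasArchParameter' hχ σ
  obtain ⟨M, hM⟩ : ∃ M : ℤ, ((χ σ).map fun x => x - (r : ℂ)).sum = M := by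
    refine exists_int_multiset_sum' fun x hx => ?_
    obtain ⟨a, ha, rfl⟩ := Multiset.mem_map.1 hx
    obtain ⟨m, hm⟩ := hcos a ha
    exact ⟨m, by rw [hm, add_sub_cancel_right]⟩
  have hNr : (N : ℂ) * r = (k : ℂ) + 1 / 2 - M := by
    rw [Multiset.sum_map_sub, Multiset.map_id', Multiset.map_const', Multiset.sum_replicate, hcardσ,
      nsmul_eq_mul, hk] at hM
    linear_combination -hM
  -- `2 r ∈ ℤ`, `N = 2 n + 1`: `r = N r - n (2 r) ∈ 1/2 + ℤ`
  obtain ⟨k₂, hk₂⟩ := h2r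
  have h2r' : (2 : ℂ) * r = (k₂ : ℂ) := by exact_mod_cast hk₂
  intro a ha
  obtain ⟨m, hm⟩ := hcos a ha
  obtain ⟨n, rfl⟩ := hN
  refine ⟨m + (k - M - n * k₂) - n, ?_⟩
  rw [hm]
  push_cast at hNr ⊢
  linear_combination hNr - (n : ℂ) * h2r'

/-- **The same with an infinity type in place of `2r ∈ ℤ`** (`AutomorphicRepData.exists_hasInfinityType`,
Clozel 1990 §3.3; `2r ∈ ℤ` is `exists_int_two_mul_of_coset`).
[cite: Mok2014, Cor. 2.5.5 with Thm. 2.4.2, Thm. 2.5.4 (a) and the following Remark (arXiv pp. 13, 20–21)]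
[cite: Clozel1990, §3.3 and Lemme 4.9] -/
theorem Mok2014_archimedean_parity_of_asaiSign_odd_neg_of_heckeCharacter
    (hdesc : Mok2014_standardBaseChange_descent)
    (h2 : Module.finrank F E = 2) {c : E ≃ₐ[F] E} (hc : c ≠ 1) (hN : Odd N)
    (P : CuspidalAutomorphicRepData N E hcpt) (hcsd : P.1.IsConjSelfDualAE c)
    (hsign : P.1.HasAsaiSign c (-1))
    {μ : HeckeCharacter E} {η₀ : HeckeCharacter F} (hη₀ : η₀.IsClassFieldCharacter E)
    (hres : ∀ x, μ (AdeleRing.ideleBaseChange F E x) = η₀ x)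
    (hunr : ∀ w : HeightOneSpectrum (𝓞 E), w.asIdeal.ramificationIdx (𝓞 F) = 1 → μ.IsUnramifiedAt w)
    (hex : P.1.exists_hasInfinityType) {χ : (E →+* ℂ) → Multiset ℂ} (hχ : P.1.HasArchParameter χ)
    {σ : E →+* ℂ} (hσ : NumberField.ComplexEmbedding.IsConj σ c) {r : ℝ}
    (hcos : ∀ a ∈ χ σ, ∃ m : ℤ, a = (m : ℂ) + (r : ℂ)) :
    ∀ a ∈ χ σ, ∃ m : ℤ, a = (m : ℂ) + ((N : ℂ) - 1) / 2 + 1 / 2 :=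
  Mok2014_archimedean_parity_of_asaiSign_odd_neg_of_heckeCharacter_of_two_mul hdesc h2 hc hN P hcsd hsign
    hη₀ hres hunr hχ hσ hcos (P.exists_int_two_mul_of_coset hc hN.pos hcsd hex hχ hσ hcos)

/-- **For odd `N`, INTEGRAL exponents at a `c`-conjugation place exclude the raw Asai sign `-1`**
(currency-free contrapositive; the mirror image of `not_hasAsaiSign_one_of_odd_of_mem_half` of
`AsaiSignArchParityCentre`): granted the standard descent and a character of `𝕀_E` over `ω_{E/F}`
unramified at the places unramified over `F`, a conjugate self-dual cuspidal `P` of odd rank whose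
exponents `χ σ` are all integers (Mok's Cor. 2.5.5 case `a_i ∈ (N+1)/2 + ℤ = ℤ` for odd `N`) does not have
the `As⁻` pole at `1⁺` at every Asai datum — i.e. `κ ≠ -1`, which with Mok's dichotomy is `κ = +1`, the
printed conclusion of Cor. 2.5.5 for odd `N` ("`Π` descends via standard base change, and does not descend
via twisted base change", arXiv p. 21), here WITHOUT the regularity `a_1 > ⋯ > a_N`.
[cite: Mok2014, Cor. 2.5.5 with Thm. 2.4.2 and the Remark after Thm. 2.5.4 (arXiv pp. 13, 21)]
[cite: GanGrossPrasad2012, §3 (paragraph before Lemma 3.4: det M is conjugate-dual of sign b^dim M) and Lemma 3.4] -/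
theorem CuspidalAutomorphicRepData.not_hasAsaiSign_neg_one_of_odd_of_mem_int
    (hdesc : Mok2014_standardBaseChange_descent)
    (h2 : Module.finrank F E = 2) {c : E ≃ₐ[F] E} (hc : c ≠ 1) (hN : Odd N)
    (P : CuspidalAutomorphicRepData N E hcpt) (hcsd : P.1.IsConjSelfDualAE c)
    {μ : HeckeCharacter E} {η₀ : HeckeCharacter F} (hη₀ : η₀.IsClassFieldCharacter E)
    (hres : ∀ x, μ (AdeleRing.ideleBaseChange F E x) = η₀ x)
    (hunr : ∀ w : HeightOneSpectrum (𝓞 E), w.asIdeal.ramificationIdx (𝓞 F) = 1 → μ.IsUnramifiedAt w)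
    {χ : (E →+* ℂ) → Multiset ℂ} (hχ : P.1.HasArchParameter χ)
    {σ : E →+* ℂ} (hσ : NumberField.ComplexEmbedding.IsConj σ c)
    (hint : ∀ a ∈ χ σ, ∃ m : ℤ, a = (m : ℂ)) : ¬ P.1.HasAsaiSign c (-1) := by
  intro hsign
  have hcos : ∀ a ∈ χ σ, ∃ m : ℤ, a = (m : ℂ) + ((0 : ℝ) : ℂ) := fun a ha => by
    obtain ⟨m, hm⟩ := hint a ha
    exact ⟨m, by rw [hm, Complex.ofReal_zero, add_zero]⟩
  have hcard : Multiset.card (χ σ) = N := card_eq_of_hasArchParameter' hχ σ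
  obtain ⟨a, ha⟩ : ∃ a, a ∈ χ σ := Multiset.card_pos_iff_exists_mem.mp (hcard ▸ hN.pos)
  obtain ⟨m, hm⟩ := Mok2014_archimedean_parity_of_asaiSign_odd_neg_of_heckeCharacter_of_two_mul hdesc h2
    hc hN P hcsd hsign hη₀ hres hunr hχ hσ hcos ⟨0, by norm_num⟩ a ha
  obtain ⟨m', hm'⟩ := hint a ha
  obtain ⟨n, rfl⟩ := hN
  -- `m' = m + n + 1/2`: impossible in `ℤ`
  have h : (2 : ℂ) * ((m' : ℂ) - m - n) = 1 := by
    push_cast at hm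
    linear_combination 2 * (hm - hm')
  have h' : (2 : ℤ) * (m' - m - n) = 1 := by exact_mod_cast h
  omega

/-- **The stratum "`N` odd, `κ = -1`" of `Mok2014_archimedean_parity_of_asaiSign` from the two named
facts `Mok2014_standardBaseChange_descent` (Mok's Thm. 2.4.2 / 2.5.4 (a): the standard descent, a.e.
Satake interface) and `HewittRoss_heckeCharacter_extension_quadratic` (`𝒵_E^- ≠ ∅`), with `2r ∈ ℤ` in
place of an infinity type** — in the fact's own binders and conclusion
`a ∈ (N-1)/2 + (1-κ)/4 + ℤ` at `κ = -1` (no use of the regularity hypothesis `(χ σ).Nodup`).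
[cite: Mok2014, Cor. 2.5.5 with Thm. 2.4.2, Thm. 2.5.4 (a) and the following Remark, §2.1 and §2.5 (arXiv pp. 7, 13, 20–21)]
[cite: HewittRoss1979, Thm. (24.12)] -/
theorem Mok2014_archimedean_parity_of_asaiSign_odd_neg_of_facts_of_two_mul
    (hdesc : Mok2014_standardBaseChange_descent) (hext : HewittRoss_heckeCharacter_extension_quadratic)
    (F E : Type) [Field F] [NumberField F] [Field E] [NumberField E] [Algebra F E] (c : E ≃ₐ[F] E)
    (h2 : Module.finrank F E = 2) (hc : c ≠ 1) (N : ℕ) (hcpt : isCompact_glFiniteIntegralLevel N E)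
    (P : CuspidalAutomorphicRepData N E hcpt) (χ : (E →+* ℂ) → Multiset ℂ) (σ : E →+* ℂ) (r : ℝ)
    (hN : Odd N) (hcsd : P.1.IsConjSelfDualAE c) (hsign : P.1.HasAsaiSign c (-1))
    (hχ : P.1.HasArchParameter χ) (hσ : NumberField.ComplexEmbedding.IsConj σ c)
    (hcos : ∀ a ∈ χ σ, ∃ m : ℤ, a = (m : ℂ) + (r : ℂ)) (h2r : ∃ k : ℤ, 2 * r = k) :
    ∀ a ∈ χ σ, ∃ m : ℤ, a = (m : ℂ) + ((N : ℂ) - 1) / 2 + (1 - (((-1 : ℤˣ) : ℤ) : ℂ)) / 4 := by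
  obtain ⟨η₀, μ, hη₀, -, hres, hunr⟩ := exists_heckeCharacter_restrict_eq_classFieldCharacter hext F E c h2 hc
  intro a ha
  obtain ⟨m, hm⟩ := Mok2014_archimedean_parity_of_asaiSign_odd_neg_of_heckeCharacter_of_two_mul hdesc h2 hc
    hN P hcsd hsign hη₀ hres hunr hχ hσ hcos h2r a ha
  exact ⟨m, by rw [hm]; push_cast; ring⟩

/-- **The stratum "`N` odd, `κ = -1`" of `Mok2014_archimedean_parity_of_asaiSign` from
`Mok2014_standardBaseChange_descent`, `HewittRoss_heckeCharacter_extension_quadratic` and an infinity type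
of `P`** (`AutomorphicRepData.exists_hasInfinityType`, Clozel 1990 §3.3), in the fact's binders, minus the
regularity hypothesis.
[cite: Mok2014, Cor. 2.5.5 with Thm. 2.4.2, Thm. 2.5.4 (a) and the following Remark, §2.1 and §2.5 (arXiv pp. 7, 13, 20–21)]
[cite: HewittRoss1979, Thm. (24.12)] [cite: Clozel1990, §3.3 and Lemme 4.9] -/
theorem Mok2014_archimedean_parity_of_asaiSign_odd_neg_of_facts
    (hdesc : Mok2014_standardBaseChange_descent) (hext : HewittRoss_heckeCharacter_extension_quadratic)
    (F E : Type) [Field F] [NumberField F] [Field E] [NumberField E] [Algebra F E] (c : E ≃ₐ[F] E)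
    (h2 : Module.finrank F E = 2) (hc : c ≠ 1) (N : ℕ) (hcpt : isCompact_glFiniteIntegralLevel N E)
    (P : CuspidalAutomorphicRepData N E hcpt) (χ : (E →+* ℂ) → Multiset ℂ) (σ : E →+* ℂ) (r : ℝ)
    (hN : Odd N) (hcsd : P.1.IsConjSelfDualAE c) (hsign : P.1.HasAsaiSign c (-1))
    (hχ : P.1.HasArchParameter χ) (hσ : NumberField.ComplexEmbedding.IsConj σ c)
    (hex : P.1.exists_hasInfinityType) (hcos : ∀ a ∈ χ σ, ∃ m : ℤ, a = (m : ℂ) + (r : ℂ)) :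
    ∀ a ∈ χ σ, ∃ m : ℤ, a = (m : ℂ) + ((N : ℂ) - 1) / 2 + (1 - (((-1 : ℤˣ) : ℤ) : ℂ)) / 4 :=
  Mok2014_archimedean_parity_of_asaiSign_odd_neg_of_facts_of_two_mul hdesc hext F E c h2 hc N hcpt P χ σ r
    hN hcsd hsign hχ hσ hcos (P.exists_int_two_mul_of_coset hc hN.pos hcsd hex hχ hσ hcos)

/-- **The CM case, free of the extension fact**: for `F` totally real and `E` totally complex (so
`𝒵_E^- ≠ ∅` is the tree's theorem `exists_heckeCharacter_restrict_eq_classFieldCharacter_of_isTotallyComplex`),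
the stratum "`N` odd, `κ = -1`" of `Mok2014_archimedean_parity_of_asaiSign` follows from
`Mok2014_standardBaseChange_descent` alone (with `2r ∈ ℤ`; this is the setting of Mok's Cor. 2.5.5 in
the applications to unitary Shimura varieties, `E` CM).
[cite: Mok2014, Cor. 2.5.5 with Thm. 2.4.2, Thm. 2.5.4 (a) and the following Remark, §2.1 and §2.5 (arXiv pp. 7, 13, 20–21)]
[cite: Weil1956, §1] -/
theorem Mok2014_archimedean_parity_of_asaiSign_odd_neg_of_isTotallyComplex_of_two_mul
    (hdesc : Mok2014_standardBaseChange_descent)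
    (F E : Type) [Field F] [NumberField F] [Field E] [NumberField E] [Algebra F E] (c : E ≃ₐ[F] E)
    (h2 : Module.finrank F E = 2) (hc : c ≠ 1) (hTR : IsTotallyReal F) (hTC : IsTotallyComplex E)
    (N : ℕ) (hcpt : isCompact_glFiniteIntegralLevel N E)
    (P : CuspidalAutomorphicRepData N E hcpt) (χ : (E →+* ℂ) → Multiset ℂ) (σ : E →+* ℂ) (r : ℝ)
    (hN : Odd N) (hcsd : P.1.IsConjSelfDualAE c) (hsign : P.1.HasAsaiSign c (-1))
    (hχ : P.1.HasArchParameter χ) (hσ : NumberField.ComplexEmbedding.IsConj σ c)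
    (hcos : ∀ a ∈ χ σ, ∃ m : ℤ, a = (m : ℂ) + (r : ℂ)) (h2r : ∃ k : ℤ, 2 * r = k) :
    ∀ a ∈ χ σ, ∃ m : ℤ, a = (m : ℂ) + ((N : ℂ) - 1) / 2 + (1 - (((-1 : ℤˣ) : ℤ) : ℂ)) / 4 := by
  obtain ⟨η₀, μ, hη₀, -, hres, hunr⟩ :=
    exists_heckeCharacter_restrict_eq_classFieldCharacter_of_isTotallyComplex F E c h2 hc hTR hTC
  intro a ha
  obtain ⟨m, hm⟩ := Mok2014_archimedean_parity_of_asaiSign_odd_neg_of_heckeCharacter_of_two_mul hdesc h2 hc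
    hN P hcsd hsign hη₀ hres hunr hχ hσ hcos h2r a ha
  exact ⟨m, by rw [hm]; push_cast; ring⟩

/-- **The CM case with an infinity type in place of `2r ∈ ℤ`.**
[cite: Mok2014, Cor. 2.5.5 with Thm. 2.4.2, Thm. 2.5.4 (a) and the following Remark (arXiv pp. 13, 20–21)]
[cite: Clozel1990, §3.3 and Lemme 4.9] -/
theorem Mok2014_archimedean_parity_of_asaiSign_odd_neg_of_isTotallyComplex
    (hdesc : Mok2014_standardBaseChange_descent)
    (F E : Type) [Field F] [NumberField F] [Field E] [NumberField E] [Algebra F E] (c : E ≃ₐ[F] E)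
    (h2 : Module.finrank F E = 2) (hc : c ≠ 1) (hTR : IsTotallyReal F) (hTC : IsTotallyComplex E)
    (N : ℕ) (hcpt : isCompact_glFiniteIntegralLevel N E)
    (P : CuspidalAutomorphicRepData N E hcpt) (χ : (E →+* ℂ) → Multiset ℂ) (σ : E →+* ℂ) (r : ℝ)
    (hN : Odd N) (hcsd : P.1.IsConjSelfDualAE c) (hsign : P.1.HasAsaiSign c (-1))
    (hχ : P.1.HasArchParameter χ) (hσ : NumberField.ComplexEmbedding.IsConj σ c)
    (hex : P.1.exists_hasInfinityType) (hcos : ∀ a ∈ χ σ, ∃ m : ℤ, a = (m : ℂ) + (r : ℂ)) :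
    ∀ a ∈ χ σ, ∃ m : ℤ, a = (m : ℂ) + ((N : ℂ) - 1) / 2 + (1 - (((-1 : ℤˣ) : ℤ) : ℂ)) / 4 :=
  Mok2014_archimedean_parity_of_asaiSign_odd_neg_of_isTotallyComplex_of_two_mul hdesc F E c h2 hc hTR hTC N
    hcpt P χ σ r hN hcsd hsign hχ hσ hcos (P.exists_int_two_mul_of_coset hc hN.pos hcsd hex hχ hσ hcos)

/-- **`Mok2014_archimedean_parity_of_asaiSign` for ODD `N` (both signs), from the named facts
`Mok2014_standardBaseChange_descent` and `HewittRoss_heckeCharacter_extension_quadratic` and the existence of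
infinity types** (`AutomorphicRepData.exists_hasInfinityType`, Clozel 1990 §3.3): the fact's statement
restricted to odd `N`, with its binders in order — `κ = +1` is
`Mok2014_archimedean_parity_of_asaiSign_odd_pos_of_standardBaseChange_descent` (`AsaiSignArchParityCentre`:
the centre of a standard weak base change), `κ = -1` is `Mok2014_archimedean_parity_of_asaiSign_odd_neg_of_facts`
(the twist by `𝒵_E^-`).  No use is made of the regularity hypothesis, of Mok's Thm. 2.4.10 at the
archimedean place, or of the Langlands classification of `GL_N(ℂ)`.
[cite: Mok2014, Cor. 2.5.5 with Thm. 2.4.2, Thm. 2.5.4 (a) and the following Remark, §2.1 and §2.5 (arXiv pp. 7, 13, 20–21)]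
[cite: HewittRoss1979, Thm. (24.12)] [cite: Clozel1990, §3.3 and Lemme 4.9] -/
theorem Mok2014_archimedean_parity_of_asaiSign_odd_of_facts
    (hdesc : Mok2014_standardBaseChange_descent) (hext : HewittRoss_heckeCharacter_extension_quadratic)
    (hex : ∀ (E : Type) [Field E] [NumberField E] (N : ℕ) (hcpt : isCompact_glFiniteIntegralLevel N E)
      (P : CuspidalAutomorphicRepData N E hcpt), P.1.exists_hasInfinityType)
    (F E : Type) [Field F] [NumberField F] [Field E] [NumberField E] [Algebra F E] (c : E ≃ₐ[F] E)
    (h2 : Module.finrank F E = 2) (hc : c ≠ 1) (N : ℕ) (hcpt : isCompact_glFiniteIntegralLevel N E)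
    (P : CuspidalAutomorphicRepData N E hcpt) (κ : ℤˣ) (χ : (E →+* ℂ) → Multiset ℂ) (σ : E →+* ℂ)
    (r : ℝ) (hN : Odd N) (hcsd : P.1.IsConjSelfDualAE c) (hsign : P.1.HasAsaiSign c κ)
    (hχ : P.1.HasArchParameter χ) (hσ : NumberField.ComplexEmbedding.IsConj σ c)
    (hcos : ∀ a ∈ χ σ, ∃ m : ℤ, a = (m : ℂ) + (r : ℂ)) :
    ∀ a ∈ χ σ, ∃ m : ℤ, a = (m : ℂ) + ((N : ℂ) - 1) / 2 + (1 - ((κ : ℤ) : ℂ)) / 4 := by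
  rcases Int.units_eq_one_or κ with rfl | rfl
  · exact Mok2014_archimedean_parity_of_asaiSign_odd_pos_of_standardBaseChange_descent hdesc F E c h2 hc N
      hcpt P χ σ r hN hcsd hsign hχ hσ (hex E N hcpt P) hcos
  · exact Mok2014_archimedean_parity_of_asaiSign_odd_neg_of_facts hdesc hext F E c h2 hc N hcpt P χ σ r hN
      hcsd hsign hχ hσ (hex E N hcpt P) hcos

/-- **`Mok2014_archimedean_parity_of_asaiSign` reduced to its stratum "`N` even"**, granted
`Mok2014_standardBaseChange_descent`, `HewittRoss_heckeCharacter_extension_quadratic` and infinity types: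
the named fact follows from its own restriction to the data with `N` even (where the centre is blind —
`ω|_{𝕀_F}` and `(-1)^{2 ∑ a_i}` are `1` for both signs — and Mok's Thm. 2.4.10 at the archimedean place
is needed beyond its determinant; cf. `Mok2014_archimedean_parity_of_asaiSign_of_facts` of
`AsaiSignContOfRawPole` for the complete closure through the continuation-currency twin).
[cite: Mok2014, Cor. 2.5.5 with Thm. 2.4.2, Thm. 2.4.10, Thm. 2.5.4 (a) and the following Remark (arXiv pp. 13, 16, 20–21)]
[cite: HewittRoss1979, Thm. (24.12)] -/
theorem Mok2014_archimedean_parity_of_asaiSign_of_facts_of_even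
    (hdesc : Mok2014_standardBaseChange_descent) (hext : HewittRoss_heckeCharacter_extension_quadratic)
    (hex : ∀ (E : Type) [Field E] [NumberField E] (N : ℕ) (hcpt : isCompact_glFiniteIntegralLevel N E)
      (P : CuspidalAutomorphicRepData N E hcpt), P.1.exists_hasInfinityType)
    (heven : ∀ (F E : Type) [Field F] [NumberField F] [Field E] [NumberField E] [Algebra F E]
      (c : E ≃ₐ[F] E), Module.finrank F E = 2 → c ≠ 1 →
      ∀ (N : ℕ) (hcpt : isCompact_glFiniteIntegralLevel N E) (P : CuspidalAutomorphicRepData N E hcpt)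
        (κ : ℤˣ) (χ : (E →+* ℂ) → Multiset ℂ) (σ : E →+* ℂ) (r : ℝ),
        Even N → 0 < N → P.1.IsConjSelfDualAE c → P.1.HasAsaiSign c κ →
        P.1.HasArchParameter χ → NumberField.ComplexEmbedding.IsConj σ c → (χ σ).Nodup →
        (∀ a ∈ χ σ, ∃ m : ℤ, a = (m : ℂ) + (r : ℂ)) →
        ∀ a ∈ χ σ, ∃ m : ℤ, a = (m : ℂ) + ((N : ℂ) - 1) / 2 + (1 - ((κ : ℤ) : ℂ)) / 4) :
    Mok2014_archimedean_parity_of_asaiSign := by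
  intro F E _ _ _ _ _ c h2 hc N hcpt P κ χ σ r hN hcsd hsign hχ hσ hnd hcos
  rcases Nat.even_or_odd N with hNe | hNo
  · exact heven F E c h2 hc N hcpt P κ χ σ r hNe hN hcsd hsign hχ hσ hnd hcos
  · exact Mok2014_archimedean_parity_of_asaiSign_odd_of_facts hdesc hext hex F E c h2 hc N hcpt P κ χ σ r hNo
      hcsd hsign hχ hσ hcos

end OddNegative

/-! ### Currency-free core: the centre of a standard weak base change that is a `𝒵_E^-`-twist -/

section TwistCentre

variable {F E : Type} [Field F] [NumberField F] [Field E] [NumberField E] [Algebra F E]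
  {N : ℕ} {hcpt : isCompact_glFiniteIntegralLevel N E}

/-- **The centre of a twist that is a standard weak base change: `ω_P|_{𝕀_F} · (μ|_{𝕀_F})^N = 1`**
(currency-free; no descent fact).  `E/F` quadratic, `c ≠ 1`; `P` an automorphic representation datum
of `GL_N(𝔸_E)` conjugate self-dual a.e. with central character (Satake shadow) `ω`; `μ` a Hecke
character of `E` whose restriction `η₀ = μ|_{𝕀_F}` is trivial on the norm group (`μ ∈ 𝒵_E`); `P'` the
twist `P ⊗ (μ ∘ det)`.  If `P'` is a weak base change of an automorphic representation of
`U_{E/F}(N)(𝔸_F)` for the STANDARD embedding, then `ω|_{𝕀_F} · η₀^N = 1`: the central character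
`ω' = μ^N ω` of `P'` (`centralCharacter_heckeTwist_eq`) is trivial on `𝕀_F`
(`restrict_centralCharacter_eq_one_of_isWeakBaseChange`, `P'` being conjugate self-dual by
`IsConjSelfDualAE.heckeTwist`).  (Mok §2.1 (2.1.9): the image of `ξ_{χ_κ}` on `W_E` is
`(χ_κ I_N, χ_κ⁻¹ I_N)`, so a parameter through `ξ_{χ_κ}` has determinant character over `χ_κ^N`; here for
the standard base change of the twist.) [cite: Mok2014, §2.1 (2.1.9) and the last diagram of §2.1, Thm. 2.4.2 (arXiv pp. 7–8, 13)]
[cite: Minguez2011, Thm. 4.1] -/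
theorem AutomorphicRepData.restrict_centralCharacter_mul_pow_eq_one_of_isWeakBaseChange_heckeTwist
    (h2 : Module.finrank F E = 2) {c : E ≃ₐ[F] E} (hc : c ≠ 1)
    {P P' : AutomorphicRepData (AutomorphyDatum.gl N E hcpt)} (hcsd : P.IsConjSelfDualAE c)
    {μ : HeckeCharacter E} {η₀ : HeckeCharacter F} (hη₀N : η₀.IsTrivialOnNormGroup E)
    (hres : ∀ x, μ (AdeleRing.ideleBaseChange F E x) = η₀ x)
    (hW : P'.W = P.W.map (mulChar (detTwist N μ))) (hW' : P'.W' = P.W'.map (mulChar (detTwist N μ)))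
    {π : UnitaryGroupAutomorphicRep F E c N hcpt} (hBC : UnitaryGroup.IsWeakBaseChange F E c N hcpt P' π)
    {ω : HeckeCharacter E}
    (hωs : ∀ {w : HeightOneSpectrum (𝓞 E)} {α : Multiset ℂ}, P.HasSatakeParamAt w α →
      ω.IsUnramifiedAt w ∧ ω.valueAtUniformizer w = α.prod)
    {ψ : HeckeCharacter F} (hψ : ∀ x, ψ x = ω (AdeleRing.ideleBaseChange F E x)) : ψ * η₀ ^ N = 1 := by
  have hdual : ∀ y : ideleGroup E, μ (c • y) * μ y = 1 :=
    HeckeCharacter.apply_smul_mul_eq_one_of_restrict h2 hc hres hη₀N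
  have hcsd' : P'.IsConjSelfDualAE c := hcsd.heckeTwist hdual hW hW'
  obtain ⟨ω', -, hω's⟩ := P'.exists_centralCharacter
  obtain ⟨ψ', hψ'⟩ := ω'.exists_restrict F
  have hψ'1 : ψ' = 1 :=
    P'.restrict_centralCharacter_eq_one_of_isWeakBaseChange h2 hc (fun h => hω's h) hcsd' hBC hψ'
  have hωω' : ω' = μ ^ N * ω :=
    AutomorphicRepData.centralCharacter_heckeTwist_eq (fun h => hωs h) (fun h => hω's h) μ hW hW'
  refine HeckeCharacter.ext fun x => ?_
  have hx : ψ' x = (1 : HeckeCharacter F) x := by rw [hψ'1]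
  rw [hψ', hωω', HeckeCharacter.mul_apply, HeckeCharacter.pow_apply, hres, ← hψ,
    HeckeCharacter.one_apply] at hx
  rw [HeckeCharacter.mul_apply, HeckeCharacter.pow_apply, HeckeCharacter.one_apply, mul_comm]
  exact hx

/-- **Odd `N`: the centre of `P` restricts to `μ|_{𝕀_F}`** when the `𝒵_E`-twist `P ⊗ μ` is a standard weak
base change (`η₀² = 1` as `η₀` is trivial on the norm group of the quadratic `E/F`, so
`ω|_{𝕀_F} = η₀^{-N} = η₀`).  For `μ ∈ 𝒵_E^-` this is "`P` descends via the TWISTED base change `ξ_{χ_-}`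
`⇒ ω_P|_{𝕀_F} = ω_{E/F}`", currency-free. [cite: Mok2014, §2.1 (2.1.9), Thm. 2.4.2 and the Remark after Thm. 2.5.4 (arXiv pp. 7, 13, 21)] -/
theorem AutomorphicRepData.restrict_centralCharacter_eq_of_isWeakBaseChange_heckeTwist_of_odd
    (h2 : Module.finrank F E = 2) {c : E ≃ₐ[F] E} (hc : c ≠ 1) (hN : Odd N)
    {P P' : AutomorphicRepData (AutomorphyDatum.gl N E hcpt)} (hcsd : P.IsConjSelfDualAE c)
    {μ : HeckeCharacter E} {η₀ : HeckeCharacter F} (hη₀N : η₀.IsTrivialOnNormGroup E)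
    (hres : ∀ x, μ (AdeleRing.ideleBaseChange F E x) = η₀ x)
    (hW : P'.W = P.W.map (mulChar (detTwist N μ))) (hW' : P'.W' = P.W'.map (mulChar (detTwist N μ)))
    {π : UnitaryGroupAutomorphicRep F E c N hcpt} (hBC : UnitaryGroup.IsWeakBaseChange F E c N hcpt P' π)
    {ω : HeckeCharacter E}
    (hωs : ∀ {w : HeightOneSpectrum (𝓞 E)} {α : Multiset ℂ}, P.HasSatakeParamAt w α →
      ω.IsUnramifiedAt w ∧ ω.valueAtUniformizer w = α.prod)
    {ψ : HeckeCharacter F} (hψ : ∀ x, ψ x = ω (AdeleRing.ideleBaseChange F E x)) : ψ = η₀ := by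
  haveI : FiniteDimensional F E := Module.finite_of_finrank_eq_succ h2
  haveI : Algebra.IsQuadraticExtension F E := ⟨h2⟩
  haveI : IsGalois F E := inferInstance
  have hprod := AutomorphicRepData.restrict_centralCharacter_mul_pow_eq_one_of_isWeakBaseChange_heckeTwist
    h2 hc hcsd hη₀N hres hW hW' hBC (fun h => hωs h) hψ
  have hcard : Fintype.card (E ≃ₐ[F] E) = 2 := by
    rw [← Nat.card_eq_fintype_card, IsGalois.card_aut_eq_finrank, h2]
  refine HeckeCharacter.ext fun x => ?_
  have hx : (ψ * η₀ ^ N) x = (1 : HeckeCharacter F) x := by rw [hprod]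
  rw [HeckeCharacter.mul_apply, HeckeCharacter.pow_apply, HeckeCharacter.one_apply] at hx
  have hη₀x : η₀ x * η₀ x = 1 := by
    have h := hη₀N.apply_pow_card x
    rwa [hcard, pow_two] at h
  obtain ⟨n, rfl⟩ := hN
  have hpow : η₀ x ^ (2 * n + 1) = η₀ x := by
    rw [pow_succ, pow_mul, pow_two, hη₀x, one_pow, one_mul]
  rw [hpow, mul_comm] at hx
  rw [eq_inv_of_mul_eq_one_right hx, inv_eq_of_mul_eq_one_right hη₀x]

/-- **Even `N`: the centre is blind** — if the `𝒵_E`-twist `P ⊗ μ` is a standard weak base change then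
`ω_P|_{𝕀_F} = η₀^{-N} = 1` whatever `μ|_{𝕀_F} = η₀ ∈ {1, ω_{E/F}}` is (so for even rank the central
character cannot distinguish `κ = ±1`; Mok's Cor. 2.5.5 then needs Thm. 2.4.10 at the archimedean place
beyond its determinant). [cite: Mok2014, §2.1 (2.1.9), Thm. 2.4.2 (arXiv pp. 7, 13)] -/
theorem AutomorphicRepData.restrict_centralCharacter_eq_one_of_isWeakBaseChange_heckeTwist_of_even
    (h2 : Module.finrank F E = 2) {c : E ≃ₐ[F] E} (hc : c ≠ 1) (hN : Even N)
    {P P' : AutomorphicRepData (AutomorphyDatum.gl N E hcpt)} (hcsd : P.IsConjSelfDualAE c)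
    {μ : HeckeCharacter E} {η₀ : HeckeCharacter F} (hη₀N : η₀.IsTrivialOnNormGroup E)
    (hres : ∀ x, μ (AdeleRing.ideleBaseChange F E x) = η₀ x)
    (hW : P'.W = P.W.map (mulChar (detTwist N μ))) (hW' : P'.W' = P.W'.map (mulChar (detTwist N μ)))
    {π : UnitaryGroupAutomorphicRep F E c N hcpt} (hBC : UnitaryGroup.IsWeakBaseChange F E c N hcpt P' π)
    {ω : HeckeCharacter E}
    (hωs : ∀ {w : HeightOneSpectrum (𝓞 E)} {α : Multiset ℂ}, P.HasSatakeParamAt w α →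
      ω.IsUnramifiedAt w ∧ ω.valueAtUniformizer w = α.prod)
    {ψ : HeckeCharacter F} (hψ : ∀ x, ψ x = ω (AdeleRing.ideleBaseChange F E x)) : ψ = 1 := by
  haveI : FiniteDimensional F E := Module.finite_of_finrank_eq_succ h2
  haveI : Algebra.IsQuadraticExtension F E := ⟨h2⟩
  haveI : IsGalois F E := inferInstance
  have hprod := AutomorphicRepData.restrict_centralCharacter_mul_pow_eq_one_of_isWeakBaseChange_heckeTwist
    h2 hc hcsd hη₀N hres hW hW' hBC (fun h => hωs h) hψ
  have hcard : Fintype.card (E ≃ₐ[F] E) = 2 := by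
    rw [← Nat.card_eq_fintype_card, IsGalois.card_aut_eq_finrank, h2]
  obtain ⟨n, rfl⟩ := hN
  have hsq : η₀ ^ (n + n) = 1 := by
    rw [← two_mul, pow_mul, ← hcard, hη₀N.pow_card, one_pow]
  rwa [hsq, mul_one] at hprod

/-- **Currency-free core of the stratum "`N` odd, `κ = -1`"**: `E/F` quadratic, `c ≠ 1`, `N` odd, `P`
cuspidal on `GL_N(𝔸_E)` conjugate self-dual a.e., `μ` a Hecke character of `E` over a character
`η₀ ≠ 1` trivial on the norm group (i.e. `η₀ = ω_{E/F}`, `μ ∈ 𝒵_E^-`), `P'` the twist `P ⊗ (μ ∘ det)`.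
If `P'` is a STANDARD weak base change from `U_{E/F}(N)` — which is what Mok's Thm. 2.4.2 / 2.5.4 (a)
provide from an `As⁻` pole of `P` in any currency (`L(s, P, As⁻) = L(s, P', As⁺)`) — and the exponents
`χ σ` at a `c`-conjugation embedding lie in `r + ℤ` with `2r ∈ ℤ`, then they lie in `1/2 + ℤ`
(`ω_P|_{𝕀_F} = η₀ ≠ 1` by `restrict_centralCharacter_eq_of_isWeakBaseChange_heckeTwist_of_odd`, then
`sum_archParameter_int_or_half_of_isConjSelfDualAE` and `r = N r - ((N-1)/2)(2r)`).  Mirror image of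
`Mok2014_archimedean_parity_of_asaiSign_odd_pos_of_isWeakBaseChange_of_two_mul` (`AsaiSignArchParityCentre`).
[cite: Mok2014, Cor. 2.5.5 with Thm. 2.4.2, Thm. 2.5.4 (a) and the following Remark, §2.1 and §2.5 (arXiv pp. 7, 13, 20–21)]
[cite: GanGrossPrasad2012, §3 (paragraph before Lemma 3.4: det M is conjugate-dual of sign b^dim M) and Lemma 3.4] -/
theorem Mok2014_archimedean_parity_of_asaiSign_odd_neg_of_isWeakBaseChange_heckeTwist_of_two_mul
    (h2 : Module.finrank F E = 2) {c : E ≃ₐ[F] E} (hc : c ≠ 1) (hN : Odd N)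
    (P P' : CuspidalAutomorphicRepData N E hcpt) (hcsd : P.1.IsConjSelfDualAE c)
    {μ : HeckeCharacter E} {η₀ : HeckeCharacter F} (hη₀N : η₀.IsTrivialOnNormGroup E) (hη₀1 : η₀ ≠ 1)
    (hres : ∀ x, μ (AdeleRing.ideleBaseChange F E x) = η₀ x)
    (hW : P'.1.W = P.1.W.map (mulChar (detTwist N μ))) (hW' : P'.1.W' = P.1.W'.map (mulChar (detTwist N μ)))
    {π : UnitaryGroupAutomorphicRep F E c N hcpt} (hBC : UnitaryGroup.IsWeakBaseChange F E c N hcpt P'.1 π)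
    {χ : (E →+* ℂ) → Multiset ℂ} (hχ : P.1.HasArchParameter χ)
    {σ : E →+* ℂ} (hσ : NumberField.ComplexEmbedding.IsConj σ c) {r : ℝ}
    (hcos : ∀ a ∈ χ σ, ∃ m : ℤ, a = (m : ℂ) + (r : ℂ)) (h2r : ∃ k : ℤ, 2 * r = k) :
    ∀ a ∈ χ σ, ∃ m : ℤ, a = (m : ℂ) + ((N : ℂ) - 1) / 2 + 1 / 2 := by
  -- the centre: `ω|_{𝕀_F} = η₀ ≠ 1`
  obtain ⟨ω, hωc, hωs⟩ := P.1.exists_centralCharacter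
  obtain ⟨ψ, hψ⟩ := ω.exists_restrict F
  have hψη : ψ = η₀ :=
    AutomorphicRepData.restrict_centralCharacter_eq_of_isWeakBaseChange_heckeTwist_of_odd h2 hc hN hcsd hη₀N
      hres hW hW' hBC (fun h => hωs h) hψ
  obtain ⟨-, -, hhalf⟩ :=
    P.1.sum_archParameter_int_or_half_of_isConjSelfDualAE h2 hc hωc (fun h => hωs h) hcsd hψ hχ hσ
  obtain ⟨k, hk⟩ := hhalf (hψη ▸ hη₀1)
  -- `N r ∈ 1/2 + ℤ`
  have hcardσ : Multiset.card (χ σ) = N := card_eq_of_hasArchParameter' hχ σ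
  obtain ⟨M, hM⟩ : ∃ M : ℤ, ((χ σ).map fun x => x - (r : ℂ)).sum = M := by
    refine exists_int_multiset_sum' fun x hx => ?_
    obtain ⟨a, ha, rfl⟩ := Multiset.mem_map.1 hx
    obtain ⟨m, hm⟩ := hcos a ha
    exact ⟨m, by rw [hm, add_sub_cancel_right]⟩
  have hNr : (N : ℂ) * r = (k : ℂ) + 1 / 2 - M := by
    rw [Multiset.sum_map_sub, Multiset.map_id', Multiset.map_const', Multiset.sum_replicate, hcardσ,
      nsmul_eq_mul, hk] at hM
    linear_combination -hM
  obtain ⟨k₂, hk₂⟩ := h2r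
  have h2r' : (2 : ℂ) * r = (k₂ : ℂ) := by exact_mod_cast hk₂
  intro a ha
  obtain ⟨m, hm⟩ := hcos a ha
  obtain ⟨n, rfl⟩ := hN
  refine ⟨m + (k - M - n * k₂) - n, ?_⟩
  rw [hm]
  push_cast at hNr ⊢
  linear_combination hNr - (n : ℂ) * h2r'

/-- **Odd rank, INTEGRAL exponents: the `𝒵_E^-`-twist is not a standard weak base change from
`U_{E/F}(N)`** — with no descent fact and in no particular currency (the mirror image of
`CuspidalAutomorphicRepData.not_isWeakBaseChange_of_odd_of_mem_half` of `AsaiSignArchParityCentre`):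
for `N` odd, `P` cuspidal on `GL_N(𝔸_E)` conjugate self-dual a.e. with all exponents of `χ σ` integers
at a `c`-conjugation embedding `σ` (Mok's Cor. 2.5.5 hypothesis (2.5.12) for odd `N`, WITHOUT the
regularity `a_1 > ⋯ > a_N`), and `μ` over `ω_{E/F}` (`η₀ ≠ 1` trivial on the norm group), no automorphic
representation `π` of `U_{E/F}(N)(𝔸_F)` has `P ⊗ (μ ∘ det)` as its standard weak base change — i.e. `P`
does not descend via the twisted base change `ξ_{χ_-}` (the second half of the printed conclusion of
Cor. 2.5.5, arXiv p. 21: "and does not descend to `U_{E/F}(N)` via twisted base change").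
[cite: Mok2014, Cor. 2.5.5 (arXiv p. 21), with §2.1 (2.1.9) and Thm. 2.4.2]
[cite: GanGrossPrasad2012, §3 (paragraph before Lemma 3.4: det M is conjugate-dual of sign b^dim M) and Lemma 3.4] -/
theorem CuspidalAutomorphicRepData.not_isWeakBaseChange_heckeTwist_of_odd_of_mem_int
    (h2 : Module.finrank F E = 2) {c : E ≃ₐ[F] E} (hc : c ≠ 1) (hN : Odd N)
    (P P' : CuspidalAutomorphicRepData N E hcpt) (hcsd : P.1.IsConjSelfDualAE c)
    {μ : HeckeCharacter E} {η₀ : HeckeCharacter F} (hη₀N : η₀.IsTrivialOnNormGroup E) (hη₀1 : η₀ ≠ 1)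
    (hres : ∀ x, μ (AdeleRing.ideleBaseChange F E x) = η₀ x)
    (hW : P'.1.W = P.1.W.map (mulChar (detTwist N μ))) (hW' : P'.1.W' = P.1.W'.map (mulChar (detTwist N μ)))
    {χ : (E →+* ℂ) → Multiset ℂ} (hχ : P.1.HasArchParameter χ)
    {σ : E →+* ℂ} (hσ : NumberField.ComplexEmbedding.IsConj σ c)
    (hint : ∀ a ∈ χ σ, ∃ m : ℤ, a = (m : ℂ)) (π : UnitaryGroupAutomorphicRep F E c N hcpt) :
    ¬ UnitaryGroup.IsWeakBaseChange F E c N hcpt P'.1 π := by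
  intro hBC
  have hcos : ∀ a ∈ χ σ, ∃ m : ℤ, a = (m : ℂ) + ((0 : ℝ) : ℂ) := fun a ha => by
    obtain ⟨m, hm⟩ := hint a ha
    exact ⟨m, by rw [hm, Complex.ofReal_zero, add_zero]⟩
  have hcard : Multiset.card (χ σ) = N := card_eq_of_hasArchParameter' hχ σ
  obtain ⟨a, ha⟩ : ∃ a, a ∈ χ σ := Multiset.card_pos_iff_exists_mem.mp (hcard ▸ hN.pos)
  obtain ⟨m, hm⟩ :=
    Mok2014_archimedean_parity_of_asaiSign_odd_neg_of_isWeakBaseChange_heckeTwist_of_two_mul h2 hc hN P P'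
      hcsd hη₀N hη₀1 hres hW hW' hBC hχ hσ hcos ⟨0, by norm_num⟩ a ha
  obtain ⟨m', hm'⟩ := hint a ha
  obtain ⟨n, rfl⟩ := hN
  have h : (2 : ℂ) * ((m' : ℂ) - m - n) = 1 := by
    push_cast at hm
    linear_combination 2 * (hm - hm')
  have h' : (2 : ℤ) * (m' - m - n) = 1 := by exact_mod_cast h
  omega

end TwistCentre

/-! ### The continuation currency: `HasAsaiPoleCont` under `𝒵_E^∓`-twists, and the odd-rank strata of
the twin fact `Mok2014_archimedean_parity_of_asaiSignCont` from a continuation-currency descent -/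

section ContCurrency

variable {F E : Type} [Field F] [NumberField F] [Field E] [NumberField E] [Algebra F E]
  {N : ℕ} {hcpt : isCompact_glFiniteIntegralLevel N E}

/-- **The local Asai factors of `P` and of its `𝒵_E^-`-twist agree with opposite signs, place by place**:
with `t_w = μ(ϖ_w)⁻¹`, `μ|_{𝕀_F} = η₀` the class-field character, `μ` unramified above `v`, every place above
`v` of ramification index `1` and the `c`-fixed ones of residue degree `2`, the local Asai polynomial of the
family `w ↦ t_w A' w` with sign `η` and that of `A'` with sign `-η` take the same value at `q_v^{-s}` (at an
inert `v`: `P^η(A')(-x) = P^{-η}(A')(x)`, `eval_asaiInertPolynomial_units_mul`; at a split one the factor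
`t_w t_{c w} = 1` disappears and the Rankin–Selberg polynomial ignores the sign). [cite: GanGrossPrasad2012, §7]
[cite: Mok2014, §2.5 (arXiv p. 20)] -/
theorem eval_asaiLocalPolynomial_heckeTwist_neg (h2 : Module.finrank F E = 2) {c : E ≃ₐ[F] E}
    (hc : c ≠ 1) {μ : HeckeCharacter E} {η₀ : HeckeCharacter F} (hη₀ : η₀.IsClassFieldCharacter E)
    (hres : ∀ x, μ (AdeleRing.ideleBaseChange F E x) = η₀ x) (A' : SatakeFamily E) (η : ℤˣ)
    {w : HeightOneSpectrum (𝓞 E)} (he : w.asIdeal.ramificationIdx (𝓞 F) = 1)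
    (hf : c • w = w → w.asIdeal.inertiaDeg (𝓞 F) = 2)
    (hunr : μ.IsUnramifiedAt w) (hunr' : μ.IsUnramifiedAt (c • w)) (x : ℂ) :
    (asaiLocalPolynomial c (fun w => (A' w).map ((μ.valueAtUniformizer w)⁻¹ * ·)) η w).eval x =
      (asaiLocalPolynomial c A' (-η) w).eval x := by
  by_cases hcw : c • w = w
  · have hval : μ.valueAtUniformizer w = -1 := by
      rw [← HeckeCharacter.valueAtUniformizer_restrict_of_smul_eq h2 hc hres hcw he hunr,
        hη₀.valueAtUniformizer_under_eq_neg_one h2 (hf hcw)]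
    have key := eval_asaiInertPolynomial_units_mul η (-1) (A' w) x
    simp only [Units.val_neg, Units.val_one, Int.cast_neg, Int.cast_one, neg_one_mul] at key
    rw [asaiLocalPolynomial_twist_of_smul_eq A' (fun w => (μ.valueAtUniformizer w)⁻¹) η hcw,
      Polynomial.eval_comp, Polynomial.eval_mul, Polynomial.eval_C, Polynomial.eval_X, hval,
      asaiLocalPolynomial_of_smul_eq A' η hcw, asaiLocalPolynomial_of_smul_eq A' (-η) hcw,
      show ((-1 : ℂ))⁻¹ * x = -x by norm_num, key]
  · have hval : (μ.valueAtUniformizer w)⁻¹ * (μ.valueAtUniformizer (c • w))⁻¹ = 1 := by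
      rw [← mul_inv, ← HeckeCharacter.valueAtUniformizer_restrict_of_smul_ne h2 hc hres hcw he hunr hunr',
        hη₀.isTrivialOnNormGroup.valueAtUniformizer_under_eq_one_of_smul_ne h2 hcw, inv_one]
    rw [asaiLocalPolynomial_twist_of_smul_ne A' (fun w => (μ.valueAtUniformizer w)⁻¹) η hcw,
      Polynomial.eval_comp, Polynomial.eval_mul, Polynomial.eval_C, Polynomial.eval_X, hval, one_mul,
      asaiLocalPolynomial_eq_of_smul_ne A' η (-η) hcw]

/-- **The `𝒵_E^-`-twist swaps the sign of the CONTINUED Asai pole** (`HasAsaiPoleCont`, the continuation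
currency of `AsaiSignCont`): same setting as `HasAsaiPole.heckeTwist_neg`; the raw partial products of
`(P, η)` and `(P ⊗ μ, -η)` over the same `S` are the same function of `s` factor by factor
(`eval_asaiLocalPolynomial_heckeTwist_neg`), so multipliability, the continuation `G` and `G(1) ≠ 0`
transfer verbatim. [cite: Mok2014, §2.5 (arXiv p. 20: L(s, φ^N, As⁻) = L(s, φ^N ⊗ χ_-, As⁺)) and Thm. 2.5.4 (a)]
[cite: GanGrossPrasad2012, §7] -/
theorem AutomorphicRepData.HasAsaiPoleCont.heckeTwist_neg (h2 : Module.finrank F E = 2) {c : E ≃ₐ[F] E}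
    (hc : c ≠ 1) {P P' : AutomorphicRepData (AutomorphyDatum.gl N E hcpt)} {η : ℤˣ}
    (hP : P.HasAsaiPoleCont c η) {μ : HeckeCharacter E} {η₀ : HeckeCharacter F}
    (hη₀ : η₀.IsClassFieldCharacter E) (hres : ∀ x, μ (AdeleRing.ideleBaseChange F E x) = η₀ x)
    (hunr : ∀ w : HeightOneSpectrum (𝓞 E), w.asIdeal.ramificationIdx (𝓞 F) = 1 → μ.IsUnramifiedAt w)
    (hW : P'.W = P.W.map (mulChar (detTwist N μ))) (hW' : P'.W' = P.W'.map (mulChar (detTwist N μ))) :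
    P'.HasAsaiPoleCont c (-η) := by
  intro S A' hA'
  have he : ∀ w : HeightOneSpectrum (𝓞 E), w.under (𝓞 F) ∉ S → w.asIdeal.ramificationIdx (𝓞 F) = 1 :=
    fun w hw => HeightOneSpectrum.ramificationIdx_eq_one_of_asai h2 (hA'.inertiaDeg_eq_two hw)
  have hμ : ∀ w : HeightOneSpectrum (𝓞 E), w.under (𝓞 F) ∉ S → μ.IsUnramifiedAt w :=
    fun w hw => hunr w (he w hw)
  have hμc : ∀ w : HeightOneSpectrum (𝓞 E), w.under (𝓞 F) ∉ S → μ.IsUnramifiedAt (c • w) :=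
    fun w hw => hμ (c • w) (by rwa [HeightOneSpectrum.under_algEquiv_smul F E c w])
  set t : HeightOneSpectrum (𝓞 E) → ℂ := fun w => (μ.valueAtUniformizer w)⁻¹ with ht
  have hA : P.IsAsaiDatum c S (fun w => (A' w).map (t w * ·)) :=
    ⟨hA'.finite, fun w hw => (hA'.hasSatakeParamAt hw).of_heckeTwist μ (hμ w hw) hW hW',
      fun w hw hcw => hA'.inertiaDeg_eq_two hw hcw⟩
  -- factor-by-factor equality above the complement of `S`
  have hfac : ∀ s : ℂ, (fun v : {v : HeightOneSpectrum (𝓞 F) // v ∉ S} =>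
      ((asaiLocalPolynomial c (fun w => (A' w).map (t w * ·)) η (placeAbove E v.1)).eval
        ((v.1.residueCard : ℂ) ^ (-s)))⁻¹) =
      fun v : {v : HeightOneSpectrum (𝓞 F) // v ∉ S} =>
        ((asaiLocalPolynomial c A' (-η) (placeAbove E v.1)).eval ((v.1.residueCard : ℂ) ^ (-s)))⁻¹ := by
    intro s
    funext v
    have hv : (placeAbove E v.1).under (𝓞 F) ∉ S := by rw [placeAbove_under]; exact v.2
    rw [ht, eval_asaiLocalPolynomial_heckeTwist_neg h2 hc hη₀ hres A' η (he _ hv)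
      (fun hcw => hA'.inertiaDeg_eq_two hv hcw) (hμ _ hv) (hμc _ hv)]
  have heq : ∀ s : ℂ, partialAsaiL S c (fun w => (A' w).map (t w * ·)) η s = partialAsaiL S c A' (-η) s :=
    fun s => by
      unfold partialAsaiL
      exact congrArg tprod (hfac s)
  obtain ⟨σ₀, hσ₀, hmult, G, hG, hGL, hG1⟩ := hP hA
  refine ⟨σ₀, hσ₀, fun s hs => ?_, G, hG, fun s hs => ?_, hG1⟩
  · rw [← hfac s]
    exact hmult s hs
  · rw [hGL s hs, heq s]

/-- **Signature rule in the continuation currency, `κ' = -1`**: `HasAsaiSignCont c κ P` gives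
`HasAsaiSignCont c (-κ) (P ⊗ μ)` for `μ` over `ω_{E/F}`. [cite: Mok2014, §2.1 (last diagram) and §2.5, arXiv pp. 7–8, 20] -/
theorem AutomorphicRepData.HasAsaiSignCont.heckeTwist_neg (h2 : Module.finrank F E = 2) {c : E ≃ₐ[F] E}
    (hc : c ≠ 1) {P P' : AutomorphicRepData (AutomorphyDatum.gl N E hcpt)} {κ : ℤˣ}
    (hP : P.HasAsaiSignCont c κ) {μ : HeckeCharacter E} {η₀ : HeckeCharacter F}
    (hη₀ : η₀.IsClassFieldCharacter E) (hres : ∀ x, μ (AdeleRing.ideleBaseChange F E x) = η₀ x)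
    (hunr : ∀ w : HeightOneSpectrum (𝓞 E), w.asIdeal.ramificationIdx (𝓞 F) = 1 → μ.IsUnramifiedAt w)
    (hW : P'.W = P.W.map (mulChar (detTwist N μ))) (hW' : P'.W' = P.W'.map (mulChar (detTwist N μ))) :
    P'.HasAsaiSignCont c (-κ) := by
  rw [AutomorphicRepData.hasAsaiSignCont_iff] at hP ⊢
  rw [mul_neg]
  exact hP.heckeTwist_neg h2 hc hη₀ hres hunr hW hW'

/-- **The stratum "`N` odd, `κ = -1`" of the continuation-currency twin
`Mok2014_archimedean_parity_of_asaiSignCont`, from a continuation-currency standard descent at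
`(F, E, c, N)`** — displayed as the hypothesis `hdescCont` (Mok, Thm. 2.4.2 with Thm. 2.5.4 (a) and
Remark 2.5.5 for the CONTINUED Asai `L`-function: a conjugate self-dual cuspidal datum with
`HasAsaiSignCont c 1` is a standard weak base change from `U_{E/F}(N)`; not a named fact of the tree,
whose `Mok2014_standardBaseChange_descent` takes the raw `HasAsaiSign c 1`) — and a character `μ` over
`ω_{E/F}` unramified at the places unramified over `F` (`𝒵_E^- ≠ ∅`, e.g.
`exists_heckeCharacter_restrict_eq_classFieldCharacter`), with `2r ∈ ℤ`: the exponents lie in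
`1/2 + ℤ = (N-1)/2 + (1-κ)/4 + ℤ`.  Proof: twist (`HasAsaiSignCont.heckeTwist_neg`), descend the twist,
`Mok2014_archimedean_parity_of_asaiSign_odd_neg_of_isWeakBaseChange_heckeTwist_of_two_mul`.
[cite: Mok2014, Cor. 2.5.5 with Thm. 2.4.2, Thm. 2.5.4 (a) and Remark 2.5.5, §2.1 and §2.5 (arXiv pp. 7, 13, 20–21)] -/
theorem Mok2014_archimedean_parity_of_asaiSignCont_odd_neg_of_contDescent_of_two_mul
    (h2 : Module.finrank F E = 2) {c : E ≃ₐ[F] E} (hc : c ≠ 1) (hN : Odd N)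
    (hdescCont : ∀ Q : CuspidalAutomorphicRepData N E hcpt, Q.1.IsConjSelfDualAE c →
      Q.1.HasAsaiSignCont c 1 → ∃ π : UnitaryGroupAutomorphicRep F E c N hcpt,
        UnitaryGroup.IsWeakBaseChange F E c N hcpt Q.1 π)
    (P : CuspidalAutomorphicRepData N E hcpt) (hcsd : P.1.IsConjSelfDualAE c)
    (hsign : P.1.HasAsaiSignCont c (-1))
    {μ : HeckeCharacter E} {η₀ : HeckeCharacter F} (hη₀ : η₀.IsClassFieldCharacter E)
    (hres : ∀ x, μ (AdeleRing.ideleBaseChange F E x) = η₀ x)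
    (hunr : ∀ w : HeightOneSpectrum (𝓞 E), w.asIdeal.ramificationIdx (𝓞 F) = 1 → μ.IsUnramifiedAt w)
    {χ : (E →+* ℂ) → Multiset ℂ} (hχ : P.1.HasArchParameter χ)
    {σ : E →+* ℂ} (hσ : NumberField.ComplexEmbedding.IsConj σ c) {r : ℝ}
    (hcos : ∀ a ∈ χ σ, ∃ m : ℤ, a = (m : ℂ) + (r : ℂ)) (h2r : ∃ k : ℤ, 2 * r = k) :
    ∀ a ∈ χ σ, ∃ m : ℤ, a = (m : ℂ) + ((N : ℂ) - 1) / 2 + (1 - (((-1 : ℤˣ) : ℤ) : ℂ)) / 4 := by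
  haveI : NeZero N := ⟨hN.pos.ne'⟩
  haveI : FiniteDimensional F E := Module.finite_of_finrank_eq_succ h2
  haveI : Algebra.IsQuadraticExtension F E := ⟨h2⟩
  haveI : IsGalois F E := inferInstance
  have hprime : (Module.finrank F E).Prime := by rw [h2]; exact Nat.prime_two
  haveI : Fact (Module.finrank F E).Prime := ⟨hprime⟩
  haveI : IsCyclic (E ≃ₐ[F] E) := isCyclic_of_prime_card (IsGalois.card_aut_eq_finrank F E)
  -- the twist and its descent
  obtain ⟨P', hW, hW'⟩ := exists_cuspidalAutomorphicRepData_twist_hecke μ P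
  have hdual : ∀ y : ideleGroup E, μ (c • y) * μ y = 1 :=
    HeckeCharacter.apply_smul_mul_eq_one_of_restrict h2 hc hres hη₀.isTrivialOnNormGroup
  have hcsd' : P'.1.IsConjSelfDualAE c := hcsd.heckeTwist hdual hW hW'
  have hsign' : P'.1.HasAsaiSignCont c 1 := by
    have h := hsign.heckeTwist_neg h2 hc hη₀ hres hunr hW hW'
    rwa [neg_neg] at h
  obtain ⟨π, hBC⟩ := hdescCont P' hcsd' hsign'
  have hη₀1 : η₀ ≠ 1 := by
    have hidx : (normGroup F E).index = 2 :=
      (index_normGroup_eq_finrank_of_isCyclic (F := F) (E := E)).trans h2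
    obtain ⟨x₀, hx₀⟩ := Subgroup.index_eq_two_iff.1 hidx
    have hx₀N : x₀ ∉ normGroup F E := by
      rcases hx₀ 1 with ⟨-, h⟩ | ⟨-, h⟩
      · exact absurd (one_mem _) h
      · rwa [one_mul] at h
    exact hη₀.ne_one hx₀N
  intro a ha
  obtain ⟨m, hm⟩ := Mok2014_archimedean_parity_of_asaiSign_odd_neg_of_isWeakBaseChange_heckeTwist_of_two_mul
    h2 hc hN P P' hcsd hη₀.isTrivialOnNormGroup hη₀1 hres hW hW' hBC hχ hσ hcos h2r a ha
  exact ⟨m, by rw [hm]; push_cast; ring⟩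

/-- **The stratum "`N` odd, `κ = +1`" of the twin fact from the same continuation-currency descent**
(the descent of `P` itself and `Mok2014_archimedean_parity_of_asaiSign_odd_pos_of_isWeakBaseChange_of_two_mul`
of `AsaiSignArchParityCentre`), for symmetry: exponents in `r + ℤ` with `2r ∈ ℤ` are integers.
[cite: Mok2014, Cor. 2.5.5 with Thm. 2.4.2, Thm. 2.5.4 (a) and Remark 2.5.5 (arXiv pp. 13, 20–21)] -/
theorem Mok2014_archimedean_parity_of_asaiSignCont_odd_pos_of_contDescent_of_two_mul
    (h2 : Module.finrank F E = 2) {c : E ≃ₐ[F] E} (hc : c ≠ 1) (hN : Odd N)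
    (hdescCont : ∀ Q : CuspidalAutomorphicRepData N E hcpt, Q.1.IsConjSelfDualAE c →
      Q.1.HasAsaiSignCont c 1 → ∃ π : UnitaryGroupAutomorphicRep F E c N hcpt,
        UnitaryGroup.IsWeakBaseChange F E c N hcpt Q.1 π)
    (P : CuspidalAutomorphicRepData N E hcpt) (hcsd : P.1.IsConjSelfDualAE c)
    (hsign : P.1.HasAsaiSignCont c 1)
    {χ : (E →+* ℂ) → Multiset ℂ} (hχ : P.1.HasArchParameter χ)
    {σ : E →+* ℂ} (hσ : NumberField.ComplexEmbedding.IsConj σ c) {r : ℝ}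
    (hcos : ∀ a ∈ χ σ, ∃ m : ℤ, a = (m : ℂ) + (r : ℂ)) (h2r : ∃ k : ℤ, 2 * r = k) :
    ∀ a ∈ χ σ, ∃ m : ℤ, a = (m : ℂ) + ((N : ℂ) - 1) / 2 + (1 - (((1 : ℤˣ) : ℤ) : ℂ)) / 4 := by
  obtain ⟨π, hBC⟩ := hdescCont P hcsd hsign
  intro a ha
  obtain ⟨m, hm⟩ := Mok2014_archimedean_parity_of_asaiSign_odd_pos_of_isWeakBaseChange_of_two_mul h2 hc hN P
    hcsd hBC hχ hσ hcos h2r a ha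
  exact ⟨m, by rw [hm]; push_cast; ring⟩

end ContCurrency

/-! ### The odd-rank stratum free of the extension fact: `𝒵_E^- ≠ ∅` is now a theorem
(`HewittRoss_heckeCharacter_extension_quadratic_holds`, `HeckeCharacterExtensionQuadraticGeneralProofs`) -/

section OddUnconditional

variable {F E : Type} [Field F] [NumberField F] [Field E] [NumberField E] [Algebra F E]
  {N : ℕ} {hcpt : isCompact_glFiniteIntegralLevel N E}

/-- **Existence of a character in Mok's `𝒵_E^-` for EVERY quadratic `E/F`**: a unitary Hecke character
`μ` of `E` over the class-field character `η₀ = ω_{E/F}` of `𝕀_F`, unramified at the places unramified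
over `F` — `exists_heckeCharacter_restrict_eq_classFieldCharacter` fed with the tree's theorem
`HewittRoss_heckeCharacter_extension_quadratic_holds` (Weil's extension principle + Dirichlet's unit
theorem).  Mok 2014, §2.1 (arXiv p. 7): "`𝒵_E^-` the set of `χ` with `χ|_{𝔸_F^×} = ω_{E/F}`".
[cite: Mok2014, §2.1 (arXiv p. 7)] [cite: Weil1956, §1] -/
theorem exists_heckeCharacter_restrict_eq_classFieldCharacter'
    (F E : Type) [Field F] [NumberField F] [Field E] [NumberField E] [Algebra F E] (c : E ≃ₐ[F] E)
    (h2 : Module.finrank F E = 2) (hc : c ≠ 1) :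
    ∃ (η₀ : HeckeCharacter F) (μ : HeckeCharacter E), η₀.IsClassFieldCharacter E ∧ μ.IsUnitary ∧
      (∀ x, μ (AdeleRing.ideleBaseChange F E x) = η₀ x) ∧
      ∀ w : HeightOneSpectrum (𝓞 E), w.asIdeal.ramificationIdx (𝓞 F) = 1 → μ.IsUnramifiedAt w :=
  exists_heckeCharacter_restrict_eq_classFieldCharacter HewittRoss_heckeCharacter_extension_quadratic_holds
    F E c h2 hc

/-- **The stratum "`N` odd, `κ = -1`" of `Mok2014_archimedean_parity_of_asaiSign` from
`Mok2014_standardBaseChange_descent` ALONE, with `2r ∈ ℤ`** (the extension fact of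
`Mok2014_archimedean_parity_of_asaiSign_odd_neg_of_facts_of_two_mul` being a theorem now): for `E/F`
quadratic, `N` odd, `P` cuspidal conjugate self-dual with the raw `As⁻` pole at every Asai datum and
exponents `χ σ ⊆ r + ℤ`, `2r ∈ ℤ`, at a `c`-conjugation embedding `σ`, every exponent lies in
`(N-1)/2 + 1/2 + ℤ`.
[cite: Mok2014, Cor. 2.5.5 with Thm. 2.4.2, Thm. 2.5.4 (a) and the following Remark, §2.1 and §2.5 (arXiv pp. 7, 13, 20–21)]
[cite: GanGrossPrasad2012, §3 (paragraph before Lemma 3.4: det M is conjugate-dual of sign b^dim M) and Lemma 3.4] -/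
theorem Mok2014_archimedean_parity_of_asaiSign_odd_neg_of_descent_of_two_mul
    (hdesc : Mok2014_standardBaseChange_descent)
    (F E : Type) [Field F] [NumberField F] [Field E] [NumberField E] [Algebra F E] (c : E ≃ₐ[F] E)
    (h2 : Module.finrank F E = 2) (hc : c ≠ 1) (N : ℕ) (hcpt : isCompact_glFiniteIntegralLevel N E)
    (P : CuspidalAutomorphicRepData N E hcpt) (χ : (E →+* ℂ) → Multiset ℂ) (σ : E →+* ℂ) (r : ℝ)
    (hN : Odd N) (hcsd : P.1.IsConjSelfDualAE c) (hsign : P.1.HasAsaiSign c (-1))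
    (hχ : P.1.HasArchParameter χ) (hσ : NumberField.ComplexEmbedding.IsConj σ c)
    (hcos : ∀ a ∈ χ σ, ∃ m : ℤ, a = (m : ℂ) + (r : ℂ)) (h2r : ∃ k : ℤ, 2 * r = k) :
    ∀ a ∈ χ σ, ∃ m : ℤ, a = (m : ℂ) + ((N : ℂ) - 1) / 2 + (1 - (((-1 : ℤˣ) : ℤ) : ℂ)) / 4 :=
  Mok2014_archimedean_parity_of_asaiSign_odd_neg_of_facts_of_two_mul hdesc
    HewittRoss_heckeCharacter_extension_quadratic_holds F E c h2 hc N hcpt P χ σ r hN hcsd hsign hχ hσ hcos h2r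

/-- **The stratum "`N` odd, `κ = -1`" from `Mok2014_standardBaseChange_descent` and an infinity type of
`P`** (`AutomorphicRepData.exists_hasInfinityType`, Clozel 1990 §3.3), no extension fact.
[cite: Mok2014, Cor. 2.5.5 with Thm. 2.4.2, Thm. 2.5.4 (a) and the following Remark, §2.1 and §2.5 (arXiv pp. 7, 13, 20–21)]
[cite: Clozel1990, §3.3 and Lemme 4.9] -/
theorem Mok2014_archimedean_parity_of_asaiSign_odd_neg_of_descent
    (hdesc : Mok2014_standardBaseChange_descent)
    (F E : Type) [Field F] [NumberField F] [Field E] [NumberField E] [Algebra F E] (c : E ≃ₐ[F] E)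
    (h2 : Module.finrank F E = 2) (hc : c ≠ 1) (N : ℕ) (hcpt : isCompact_glFiniteIntegralLevel N E)
    (P : CuspidalAutomorphicRepData N E hcpt) (χ : (E →+* ℂ) → Multiset ℂ) (σ : E →+* ℂ) (r : ℝ)
    (hN : Odd N) (hcsd : P.1.IsConjSelfDualAE c) (hsign : P.1.HasAsaiSign c (-1))
    (hχ : P.1.HasArchParameter χ) (hσ : NumberField.ComplexEmbedding.IsConj σ c)
    (hex : P.1.exists_hasInfinityType) (hcos : ∀ a ∈ χ σ, ∃ m : ℤ, a = (m : ℂ) + (r : ℂ)) :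
    ∀ a ∈ χ σ, ∃ m : ℤ, a = (m : ℂ) + ((N : ℂ) - 1) / 2 + (1 - (((-1 : ℤˣ) : ℤ) : ℂ)) / 4 :=
  Mok2014_archimedean_parity_of_asaiSign_odd_neg_of_facts hdesc HewittRoss_heckeCharacter_extension_quadratic_holds
    F E c h2 hc N hcpt P χ σ r hN hcsd hsign hχ hσ hex hcos

/-- **For odd `N`, integral exponents at a `c`-conjugation place exclude the raw Asai sign `-1`**, granted
only the standard descent (the `𝒵_E^-`-character of `not_hasAsaiSign_neg_one_of_odd_of_mem_int` now
exists unconditionally): Mok's Cor. 2.5.5 for odd `N` in contrapositive form, without regularity.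
[cite: Mok2014, Cor. 2.5.5 with Thm. 2.4.2 and the Remark after Thm. 2.5.4 (arXiv pp. 13, 21)] -/
theorem CuspidalAutomorphicRepData.not_hasAsaiSign_neg_one_of_odd_of_mem_int'
    (hdesc : Mok2014_standardBaseChange_descent)
    (h2 : Module.finrank F E = 2) {c : E ≃ₐ[F] E} (hc : c ≠ 1) (hN : Odd N)
    (P : CuspidalAutomorphicRepData N E hcpt) (hcsd : P.1.IsConjSelfDualAE c)
    {χ : (E →+* ℂ) → Multiset ℂ} (hχ : P.1.HasArchParameter χ)
    {σ : E →+* ℂ} (hσ : NumberField.ComplexEmbedding.IsConj σ c)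
    (hint : ∀ a ∈ χ σ, ∃ m : ℤ, a = (m : ℂ)) : ¬ P.1.HasAsaiSign c (-1) := by
  obtain ⟨η₀, μ, hη₀, -, hres, hunr⟩ := exists_heckeCharacter_restrict_eq_classFieldCharacter' F E c h2 hc
  exact P.not_hasAsaiSign_neg_one_of_odd_of_mem_int hdesc h2 hc hN hcsd hη₀ hres hunr hχ hσ hint

/-- **`Mok2014_archimedean_parity_of_asaiSign` for ODD `N` (both signs) from
`Mok2014_standardBaseChange_descent` and infinity types alone** — the fact restricted to odd `N`, in its
own binders: `κ = +1` by the centre of a standard weak base change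
(`Mok2014_archimedean_parity_of_asaiSign_odd_pos_of_standardBaseChange_descent`), `κ = -1` by the twist by
`𝒵_E^-` (`Mok2014_archimedean_parity_of_asaiSign_odd_neg_of_descent`); no regularity hypothesis, no
Thm. 2.4.10 at the archimedean place, no extension fact.
[cite: Mok2014, Cor. 2.5.5 with Thm. 2.4.2, Thm. 2.5.4 (a) and the following Remark, §2.1 and §2.5 (arXiv pp. 7, 13, 20–21)]
[cite: Clozel1990, §3.3 and Lemme 4.9] -/
theorem Mok2014_archimedean_parity_of_asaiSign_odd_of_descent
    (hdesc : Mok2014_standardBaseChange_descent)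
    (hex : ∀ (E : Type) [Field E] [NumberField E] (N : ℕ) (hcpt : isCompact_glFiniteIntegralLevel N E)
      (P : CuspidalAutomorphicRepData N E hcpt), P.1.exists_hasInfinityType)
    (F E : Type) [Field F] [NumberField F] [Field E] [NumberField E] [Algebra F E] (c : E ≃ₐ[F] E)
    (h2 : Module.finrank F E = 2) (hc : c ≠ 1) (N : ℕ) (hcpt : isCompact_glFiniteIntegralLevel N E)
    (P : CuspidalAutomorphicRepData N E hcpt) (κ : ℤˣ) (χ : (E →+* ℂ) → Multiset ℂ) (σ : E →+* ℂ)
    (r : ℝ) (hN : Odd N) (hcsd : P.1.IsConjSelfDualAE c) (hsign : P.1.HasAsaiSign c κ)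
    (hχ : P.1.HasArchParameter χ) (hσ : NumberField.ComplexEmbedding.IsConj σ c)
    (hcos : ∀ a ∈ χ σ, ∃ m : ℤ, a = (m : ℂ) + (r : ℂ)) :
    ∀ a ∈ χ σ, ∃ m : ℤ, a = (m : ℂ) + ((N : ℂ) - 1) / 2 + (1 - ((κ : ℤ) : ℂ)) / 4 :=
  Mok2014_archimedean_parity_of_asaiSign_odd_of_facts hdesc HewittRoss_heckeCharacter_extension_quadratic_holds hex
    F E c h2 hc N hcpt P κ χ σ r hN hcsd hsign hχ hσ hcos

/-- **`Mok2014_archimedean_parity_of_asaiSign` reduced to its stratum "`N` even", granted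
`Mok2014_standardBaseChange_descent` and infinity types** (the extension fact of
`Mok2014_archimedean_parity_of_asaiSign_of_facts_of_even` is a theorem now): what remains of the named
fact beyond the standard descent is exactly Mok's Thm. 2.4.10 at the archimedean place for even `N`,
where the centre is blind.
[cite: Mok2014, Cor. 2.5.5 with Thm. 2.4.2, Thm. 2.4.10, Thm. 2.5.4 (a) and the following Remark (arXiv pp. 13, 16, 20–21)] -/
theorem Mok2014_archimedean_parity_of_asaiSign_of_descent_of_even
    (hdesc : Mok2014_standardBaseChange_descent)
    (hex : ∀ (E : Type) [Field E] [NumberField E] (N : ℕ) (hcpt : isCompact_glFiniteIntegralLevel N E)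
      (P : CuspidalAutomorphicRepData N E hcpt), P.1.exists_hasInfinityType)
    (heven : ∀ (F E : Type) [Field F] [NumberField F] [Field E] [NumberField E] [Algebra F E]
      (c : E ≃ₐ[F] E), Module.finrank F E = 2 → c ≠ 1 →
      ∀ (N : ℕ) (hcpt : isCompact_glFiniteIntegralLevel N E) (P : CuspidalAutomorphicRepData N E hcpt)
        (κ : ℤˣ) (χ : (E →+* ℂ) → Multiset ℂ) (σ : E →+* ℂ) (r : ℝ),
        Even N → 0 < N → P.1.IsConjSelfDualAE c → P.1.HasAsaiSign c κ →
        P.1.HasArchParameter χ → NumberField.ComplexEmbedding.IsConj σ c → (χ σ).Nodup →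
        (∀ a ∈ χ σ, ∃ m : ℤ, a = (m : ℂ) + (r : ℂ)) →
        ∀ a ∈ χ σ, ∃ m : ℤ, a = (m : ℂ) + ((N : ℂ) - 1) / 2 + (1 - ((κ : ℤ) : ℂ)) / 4) :
    Mok2014_archimedean_parity_of_asaiSign :=
  Mok2014_archimedean_parity_of_asaiSign_of_facts_of_even hdesc HewittRoss_heckeCharacter_extension_quadratic_holds
    hex heven

/-- **The stratum "`N` odd, `κ = -1`" of the twin fact `Mok2014_archimedean_parity_of_asaiSignCont` from a
continuation-currency standard descent ALONE** (the `𝒵_E^-`-character of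
`Mok2014_archimedean_parity_of_asaiSignCont_odd_neg_of_contDescent_of_two_mul` now exists unconditionally,
`exists_heckeCharacter_restrict_eq_classFieldCharacter'`), with `2r ∈ ℤ`.
[cite: Mok2014, Cor. 2.5.5 with Thm. 2.4.2, Thm. 2.5.4 (a) and Remark 2.5.5, §2.1 and §2.5 (arXiv pp. 7, 13, 20–21)] -/
theorem Mok2014_archimedean_parity_of_asaiSignCont_odd_neg_of_contDescent_of_two_mul'
    (h2 : Module.finrank F E = 2) {c : E ≃ₐ[F] E} (hc : c ≠ 1) (hN : Odd N)
    (hdescCont : ∀ Q : CuspidalAutomorphicRepData N E hcpt, Q.1.IsConjSelfDualAE c →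
      Q.1.HasAsaiSignCont c 1 → ∃ π : UnitaryGroupAutomorphicRep F E c N hcpt,
        UnitaryGroup.IsWeakBaseChange F E c N hcpt Q.1 π)
    (P : CuspidalAutomorphicRepData N E hcpt) (hcsd : P.1.IsConjSelfDualAE c)
    (hsign : P.1.HasAsaiSignCont c (-1))
    {χ : (E →+* ℂ) → Multiset ℂ} (hχ : P.1.HasArchParameter χ)
    {σ : E →+* ℂ} (hσ : NumberField.ComplexEmbedding.IsConj σ c) {r : ℝ}
    (hcos : ∀ a ∈ χ σ, ∃ m : ℤ, a = (m : ℂ) + (r : ℂ)) (h2r : ∃ k : ℤ, 2 * r = k) :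
    ∀ a ∈ χ σ, ∃ m : ℤ, a = (m : ℂ) + ((N : ℂ) - 1) / 2 + (1 - (((-1 : ℤˣ) : ℤ) : ℂ)) / 4 := by
  obtain ⟨η₀, μ, hη₀, -, hres, hunr⟩ := exists_heckeCharacter_restrict_eq_classFieldCharacter' F E c h2 hc
  exact Mok2014_archimedean_parity_of_asaiSignCont_odd_neg_of_contDescent_of_two_mul h2 hc hN hdescCont P hcsd
    hsign hη₀ hres hunr hχ hσ hcos h2r

/-- **The odd-rank half of `Mok2014_archimedean_parity_of_asaiSignCont` (both signs) from a
continuation-currency standard descent at `(F, E, c, N)` and `2r ∈ ℤ`** — assembled from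
`Mok2014_archimedean_parity_of_asaiSignCont_odd_pos_of_contDescent_of_two_mul` (the centre) and
`Mok2014_archimedean_parity_of_asaiSignCont_odd_neg_of_contDescent_of_two_mul'` (the twist by `𝒵_E^-`):
for the crux pane law this serves the `n`-odd half without Mok's Thm. 2.4.10 at the archimedean place.
[cite: Mok2014, Cor. 2.5.5 with Thm. 2.4.2, Thm. 2.5.4 (a) and Remark 2.5.5, §2.1 and §2.5 (arXiv pp. 7, 13, 20–21)] -/
theorem Mok2014_archimedean_parity_of_asaiSignCont_odd_of_contDescent_of_two_mul
    (h2 : Module.finrank F E = 2) {c : E ≃ₐ[F] E} (hc : c ≠ 1) (hN : Odd N)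
    (hdescCont : ∀ Q : CuspidalAutomorphicRepData N E hcpt, Q.1.IsConjSelfDualAE c →
      Q.1.HasAsaiSignCont c 1 → ∃ π : UnitaryGroupAutomorphicRep F E c N hcpt,
        UnitaryGroup.IsWeakBaseChange F E c N hcpt Q.1 π)
    (P : CuspidalAutomorphicRepData N E hcpt) (hcsd : P.1.IsConjSelfDualAE c) {κ : ℤˣ}
    (hsign : P.1.HasAsaiSignCont c κ)
    {χ : (E →+* ℂ) → Multiset ℂ} (hχ : P.1.HasArchParameter χ)
    {σ : E →+* ℂ} (hσ : NumberField.ComplexEmbedding.IsConj σ c) {r : ℝ}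
    (hcos : ∀ a ∈ χ σ, ∃ m : ℤ, a = (m : ℂ) + (r : ℂ)) (h2r : ∃ k : ℤ, 2 * r = k) :
    ∀ a ∈ χ σ, ∃ m : ℤ, a = (m : ℂ) + ((N : ℂ) - 1) / 2 + (1 - ((κ : ℤ) : ℂ)) / 4 := by
  rcases Int.units_eq_one_or κ with rfl | rfl
  · exact Mok2014_archimedean_parity_of_asaiSignCont_odd_pos_of_contDescent_of_two_mul h2 hc hN hdescCont P hcsd
      hsign hχ hσ hcos h2r
  · exact Mok2014_archimedean_parity_of_asaiSignCont_odd_neg_of_contDescent_of_two_mul' h2 hc hN hdescCont P hcsd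
      hsign hχ hσ hcos h2r

end OddUnconditional

end Literature.NumberTheory.Automorphic
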